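import Summits.Langlands.Langlands.Theses.SkinnerWilesDefectOne
import Summits.Langlands.Langlands.Theorems.ProModularOrdinaryClassical.Negative.LoadBearing
import Summits.Langlands.Langlands.Theorems.ProModularOrdinaryClassical.Negative.PointsIntegral
import Summits.Langlands.Langlands.Theorems.ProModularOrdinaryClassical.Negative.SlopeDichotomy
import Summits.Langlands.Langlands.Theorems.ProModularOrdinaryClassical.Negative.FrobeniusIntegrality
import Summits.Langlands.Langlands.Theorems.ProModularOrdinaryClassical.Negative.DeterminantShadow
import Summits.Langlands.Langlands.Theorems.EisensteinProModularSeed.Negative.BorelAndEisenstein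
import Literature.FieldTheory.AlgClosed.PadicAlgClEquivComplex
import Literature.NumberTheory.Automorphic.OrdinaryCompletedCohomologyGL

/-!
# Disproof of `ProModularOrdinaryClassical` (stmt-Langlands-12921) — standing disprover's work file

Crux: `Summit.Langlands.Langlands.Theses.SkinnerWilesDefectOne.ProModularOrdinaryClassical`
(route SkinnerWilesDefectOne, rank 4, THE EXIT): for `F` imaginary quadratic, `p` odd, every
irreducible, a.e.-unramified `ρ : Γ_F → GL₂(ℚ̄_p)` that is `p`-adically automorphic of some tame
level (`∃ 𝒰, 𝒰.IsPadicallyAutomorphic ρ`) and ordinary of ONE parallel weight `k ≥ 2` with a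
positive inertial exponent `m` at every `v ∣ p` is classical: `∃ π` cuspidal L-algebraic on
`GL₂(𝔸_F)` with Satake–Frobenius matching at almost all `v`.

**cdisprove gen 1, cycle 1** (2026-08-16). VERDICT: **no kill, and none is possible short of a
counterexample to Fontaine–Mazur–Langlands (B) for `GL₂` over an imaginary quadratic field**:
§0 proves `OrdinaryFontaineMazur → ProModularOrdinaryClassical`, i.e. the crux is the conjunct
(B) of the summit restricted to the sector {irreducible, a.e. unramified, ordinary of parallel
weight `k ≥ 2`} PLUS one extra hypothesis (pro-modularity).  A witness against the crux is a
witness against (B) in that sector (ordinary of weight `k ≥ 2` ⇒ potentially semistable at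
`v ∣ p`, Hodge–Tate weights `{0, k-1}` at every embedding, so `ρ` is geometric and regular).
What this file offers instead is NEGATIVE KNOWLEDGE for provers / ideators / planners.

**cdisprove gen 2, cycle 2** (2026-08-16). VERDICT: **still no kill** — the cycle-1 reduction
stands (§0: a witness against the crux is a counterexample to Fontaine–Mazur–Langlands (B) for
`GL₂` over an imaginary quadratic field), and a second, independent audit of every interface the
crux quantifies over (local Galois groups `absInertia`/`absMaximalIdeal`, `cyclotomicCharacter`,
`toLocal`/`absGaloisRestrict`, `heckeFrobPoly`/`IsAssociated`/`IsPadicallyAutomorphic`, and — for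
the lines — `ordinaryPart`/`ordT`/`IsOrdinarilyPadicallyAutomorphic`/`IsSlopeZeroAt`) found NO junk
model and NO vacuous binder (§5). What is NEW and checked: (i) the remaining binders `ι` and `hcpt`
are inhabited (§5: `iota_nonempty`, `hcpt_holds` — the crux is not provable for lack of an
`ι : ℚ̄_p ≃+* ℂ`); (ii) LANDED `Negative/PointsIntegral.lean` (p76014): continuous `ℚ̄_p`-points of
`𝕋(𝒰)`, of the Hida-tower algebra `𝕋^S(𝒰; p)` and of Hida's ordinary algebra `𝕋^{S,ord}(𝒰)` are
INTEGRAL (`‖x t‖ ≤ 1`, no finiteness / commutativity / automorphic input), whence (§6) Frobenius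
traces and determinants of every pro-modular `ρ` are integral at good places and (§7) the "slope
dichotomy" stub of the round-1 lines is a THEOREM with no automorphic content: LANDED
`Negative/SlopeDichotomy.lean` (p77203) proves the card's exact `SlopeDichotomy`
(`IsSlopeZeroAt x v ∨ x(U_{v,1})^{m!} → 0`) and `IsSlopeZeroAt x v ↔ ‖x(U_{v,1})‖ = 1`, via
Teichmüller convergence `u^{m!} → 1` on the unit sphere of `ℚ̄_p` (`unitBranch_holds`); (iii) PRE-ATTACK findings
on the presumptive stubs (§7): the typed split hypothesis `∀ v ∣ p, N v = p` of
`OrdinaryFactorisationSplit` also admits RAMIFIED `p` (where `GL₂(F_v) ≠ GL₂(ℚ_p)` and the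
Paškūnas-block lever is unavailable) — corrected shape `SplitsCompletelyAt`; and
`OrdinaryPointsClassical` as typed (ordinarily pro-modular + Galois-ordinary of weight `k` ⇒
classical) still CONTAINS a Galois ⇒ Hecke statement at `p` (the `Λ`-weight of the point must be
read off `ρ|_{I_v}`: Wiles' `Λ`-adic local–global compatibility, open over `F`), so the split
"OrdinaryFactorisation ∘ OrdinaryPointsClassical" does not isolate the open content in its first
factor unless the weight character is put into the interface. Corner recorded: `F = ℚ(√-3), p = 3`
(`ζ_p ∈ F`) is inside the crux and outside every printed automorphy-lifting theorem's hypotheses.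

**cdisprove gen 3, cycle 3** (2026-08-16). VERDICT: **no kill of the crux** (unchanged: §0 — a kill is
a counterexample to Fontaine–Mazur–Langlands (B) over an imaginary quadratic field). The line
`top-degree-exact-control` is PICKED (skeleton rev 2); its six registered stubs are this cycle's
`-- Targets` (§9): **T2b `stub_slotZeroDiamondWeight` is DEAD AS TYPED** — the drefute seat's paper witness
(companion ordinary refinement of a split-at-`p` CM point) is now backed by a CHECKED, convention-free Lean
core (§9b `SlotZero.*`; proposal p82696 `Theorems/ProModularOrdinaryClassical/Negative/SlotZeroWeight.lean`):
the slot-`0` diamond weight of ANY point of `𝕋^{S,ord}(𝒰)` is a well-defined integer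
(`HasSlotZeroWeight.unique`, witness `u = p + 1`), the stub asserts weight `0` at EVERY associated point, so
ONE associated point of non-zero slot-`0` weight refutes it (`stub_false_of_hasSlotZeroWeight`;
`NonzeroSlotZeroWeightPoint → ¬ Stub`). T1 = (OF) stays open and must absorb the ordering (drefute R1);
T2a, T2c, T3, T4 survive with prover briefings (§9). v5 also imports all five landed `Negative/` modules
(`unitBranch_holds` is now a theorem; v4 local copies demoted to `example`s) — §10 is the cycle-3 log.

## Findings index (everything below the module docstring is `lean check`ed, no `sorry`)
* §0 `OrdinaryFontaineMazur`, `crux_of_ordinaryFontaineMazur` — the pro-modularity hypothesis is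
  LOGICALLY REDUNDANT modulo FM: a proof of the crux that never uses `hpm` is a proof of
  Fontaine–Mazur in this sector.  `satakeConclusion_of_galoisToAutomorphic` (landed),
  `crux_of_summitB` — the crux follows from the summit's (B) for any reciprocity data `𝓡`
  for which "ordinary of weight `k ≥ 2` ⇒ `IsGeometricFramed 𝓡`" (de Rham w.r.t. the datum's
  placeholder `pst`); so NO refutation of the crux can avoid refuting `Langlands` itself once that
  bridge is available.
* §1 LOAD-BEARING ANALYSIS (which hypotheses matter, as theorems where Lean can say something):
  - `eventually_isUnramifiedAt_of_isPadicallyAutomorphic`, `WithoutUnramified`,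
    `crux_iff_withoutUnramified` — the hypothesis `∀ᶠ v in cofinite, ρ.IsUnramifiedAt v` is
    IMPLIED by pro-modularity (`IsAssociated` forces unramifiedness off the finite set `𝒰.bad`):
    it is decoration; provers may drop it.
  - `exists_uniform_exponent`, `crux_iff_perPlaceExponent` — "one `m` for all `v ∣ p`" is
    equivalent to "some `m_v > 0` at each `v ∣ p`" (finitely many places above `p`,
    monotonicity `IsOrdinaryOfWeightAt.of_dvd`): the uniform `m` is not a restriction.
  - `isOrdinaryOfWeight_exponent_zero_iff`, `WithExponentZero` — dropping `0 < m` DEGENERATES the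
    statement: with `m = 0` both inertial clauses are `x ^ 0 = 1`, the weight `k` disappears and
    "ordinary" collapses to "upper-triangularisable on `Γ_{F_v}`"; the `m = 0` variant asserts that
    every irreducible pro-modular locally-reducible `ρ` is classical L-algebraic — morally FALSE
    (non-classical specialisations of nearly ordinary families in non-arithmetic weight,
    Hida / Calegari–Mazur), but a Lean witness needs an explicit non-classical pro-modular `ρ`
    (not constructible with the present library). `0 < m` is LOAD-BEARING.
  - `isOrdinaryOfWeight_weight_zero_iff_one` — `k = 0` is ℕ-subtraction junk for `k = 1`
    (`0 - 1 = 0 = 1 - 1`): weight "zero" = weight one = potentially unramified at `p`.  The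
    `k ≤ 1` slice is Artin-type (FM ⇒ finite image); its conclusion is still predicted (Artin,
    L-algebraic `π(ρ)`), so `2 ≤ k` is load-bearing for the METHOD (Hida theory needs
    cohomological weight; weight one is not cohomological for Bianchi groups), not for truth.
  - `WithoutIrreducible` (def only) — morally FALSE: the Eisenstein eigensystem of `H⁰(X_U, ℤ/p^s)`
    (functions on the ray class set, `T_{v,1} ↦ q_v + 1`, `T_{v,2} ↦ 1`) is a continuous point
    of `𝕋(𝒰)` associated with `ρ = ε ⊕ 1`, ordinary of weight 2 (`m = 1`), unramified away from
    `p`, and no CUSPIDAL `π` has these Satake parameters (Jacquet–Shalika).  Not provable here: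
    needs the Hecke action on `H⁰` of the constructed tower unfolded (`groupCohomology` in degree
    0 + double-coset decomposition of `GL₂(𝒪_v) diag(ϖ,1) GL₂(𝒪_v)`) AND Jacquet–Shalika, neither
    in the tree.  Irreducibility is LOAD-BEARING (as expected: it is what excludes Eisenstein
    points).
  - `p ≠ 2`, "`F` imaginary quadratic": load-bearing for the method only (FM predicts the
    conclusion for every number field and every `p`); no `_false_without_` theorem can exist
    short of ¬FM.
* §1f (gen 2) `WithOrdinaryAtSomePlace`, `exists_place_above`, `crux_of_withOrdinaryAtSomePlace` — ordinarity at EVERY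
  `v ∣ p` is load-bearing, with an HONEST (paper) witness at split `p`: twists `ρ₀ ⊗ χ_t` of any
  classical point by a character of `Γ_F` infinitely, non-algebraically ramified at `v̄` only —
  ordinary of weight `k` at `v`, not de Rham at `v̄`, pro-modular, irreducible,
  matched by no `π` for ANY `ι` (the central character `ι∘det ρ_t∘Art` is not continuous on ideles) —
  the first variant whose falsity does not go through ¬FM; formal half = `Negative/DeterminantShadow.lean`
  (`exists_heckeCharacter_of_satakeConclusion`, `det_frob_eq_of_satakeFrobCompatibleAt`); the same twist
  at both places is an honest witness against §1c's `WithExponentZero`.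
* §2 NATURAL STRENGTHENINGS: `WithPerPlaceWeights` (non-parallel `k_v`) — NOT refutable either:
  an irreducible ordinary `ρ` of non-parallel regular weight over a CM field contradicts
  FM + purity (Clozel's purity lemma; Calegari–Mazur 2009 §1, §7), so FM predicts the
  strengthened statement vacuously on its new part.  Recorded as a def with this note.
* §3 NON-VACUITY at type level: `tameLevel_nonempty` (`TameLevel.full`); irreducible continuous
  `ρ` exist but are not built here.
* §4 ATTACK LOG and WHY IT RESISTS (docstring at the end).

* §5 (gen 2) TYPE-LEVEL NON-VACUITY COMPLETED and interface audit: `iota_nonempty`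
  (`Nonempty (PadicAlgCl p ≃+* ℂ)`, from `PadicAlgCl.nonempty_ringEquiv_complex`), `hcpt_holds`
  (`isCompact_glFiniteIntegralLevel 2 F`, from `isCompact_glFiniteIntegralLevel_holds`),
  `heckeFrobPoly_two_eisenstein` (`P_v` at the `H⁰`/Eisenstein eigensystem `(q+1, 1)` is
  `(X - 1)(X - q)`: the arithmetic-Frobenius char-poly of `1 ⊕ ε`), `not_isIrreducible_of_borelFrame`
  (re-export: a `ρ` upper-triangular in one global frame is reducible — the formal half of §1e);
  docstring audit of `absInertia`, `cyclotomicCharacter`, `toLocal`, orientation of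
  `IsOrdinaryOfWeight` (cyclotomic character on the SUB-line: the opposite orientation would admit
  non-de-Rham extensions, `H¹_g(ℚ_p(1-k)) = 0`), `ordinaryPart`/`ordT` (junk `0` only off Hida
  places, never inside `IsOrdAssociated`).
* §6 (gen 2) INTEGRALITY (uses landed `Negative/PointsIntegral.lean`): `hpm_point_integral` (the
  crux's H3 yields an INTEGRAL continuous eigensystem), `norm_trace_det_frob_le_one` (for pro-modular
  `ρ`: `‖tr ρ(Frob_v)‖ ≤ 1`, `‖det ρ(Frob_v)‖ ≤ 1` at every good `v`, arithmetic Frobenius) — a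
  would-be counterexample cannot use a non-integral junk point; nothing here distinguishes classical
  from non-classical points (as it must be: the crux is FM-hard).
* §7 (gen 2) PRE-ATTACK ON THE PRESUMPTIVE STUBS of the round-1 lines (no line picked yet):
  `slopeDichotomy_norm` (for every continuous `ℚ̄_p`-point `x` of `𝕋^S(𝒰; p)` and every `w, j`:
  `‖x(T_{w,j})‖ = 1 ∨ (‖x(T_{w,j})‖ < 1 ∧ x(T_{w,j})^{m!} → 0)` — the card `split-prime-paskunas-fibre`'s
  `SlopeDichotomy` minus its unit-branch limit is a THEOREM with zero automorphic content),
  `UnitBranch` (def: `‖u‖ = 1 ⇒ u^{m!} → 1` in `ℚ̄_p`) and `unitBranch_holds` (PROVED — landed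
  `Negative/SlopeDichotomy.lean`, p77203: `tendsto_pow_factorial_nhds_one`, `isSlopeZeroAt_iff_norm_eq_one`,
  `slopeDichotomy` = the card's stub verbatim), `isSlopeZeroAt_of_norm_eq_one` /
  `norm_eq_one_of_isSlopeZeroAt`;
  `SplitHypothesisAsTyped` vs `SplitsCompletelyAt` (defs; the typed "`p` split" clause admits ramified
  `p`); docstring findings on `OrdinaryPointsClassical` (hidden `Λ`-weight compatibility) and the
  `ζ_p ∈ F` corner.
* §8 (gen 2) attack log of cycle 2, WHY IT STILL RESISTS, next regimes.
* §9 (gen 3) TARGETS = the six registered stubs of the picked line: statuses, hazards, prover briefings;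
  §9b `SlotZero.*` — `exists_units_coe_eq_algebraMap` / `not_mem_asIdeal_of_units` (the `û`-binder of the
  diamond stubs is inhabited iff `u` is prime to `p`), `HasDiamondWeight.unique` (an algebraic weight of ANY
  quantity `P(u, û)` is unique — centre, slot `0`, slot `1`), `HasSlotZeroWeight`, `HasSlotZeroWeight.unique`
  (slot-`0` weight well defined), `Stub` (= `stub_slotZeroDiamondWeight` verbatim),
  `hasSlotZeroWeight_zero_of_stub`, `stub_false_of_hasSlotZeroWeight`, `NonzeroSlotZeroWeightPoint`,
  `stub_false_of_nonzeroSlotZeroWeightPoint`.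
* §10 (gen 3) attack log of cycle 3.

Nothing here is a `¬`-theorem about the crux (one conditional `¬`-theorem about a STUB: §9b). LANDED
(p72520, commit b0abac952819) and imported:
`Summits/Langlands/Langlands/Theorems/ProModularOrdinaryClassical/Negative/LoadBearing.lean`
(namespace `…Theorems.ProModularOrdinaryClassical.Negative`): `eventually_isUnramifiedAt_of_isPadicallyAutomorphic`,
`exists_uniform_exponent`, `isOrdinaryOfWeight_exponent_zero_iff`,
`isOrdinaryOfWeight_exponent_zero_weight_irrel`, `isOrdinaryOfWeight_weight_zero_iff_one`,
`satakeConclusion_of_galoisToAutomorphic` — the statements below USE them (no duplication).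
Gen 2 LANDED (p76014, commit 766b1d43669e) and imported: `…/Negative/PointsIntegral.lean`
(`norm_apply_le_one_of_continuous{,_hida,_ord}`, `norm_hidaT_eq_one_or_lt_one`,
`smul_cohomology_modPow_eq_zero`, `natCast_{end,hidaEnd,ordEnd}Factor_eq_zero`,
`tendsto_pow_factorial_nhds_zero_of_norm_lt_one`, abstract
`norm_apply_le_one_of_continuous_of_natCast_eq_zero`). Gen 2 also LANDED `…/Negative/SlopeDichotomy.lean` (p77203: Teichmüller convergence
`tendsto_pow_factorial_nhds_one`, `exists_norm_pow_sub_one_lt_one`, ultrametric estimates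
`norm_one_add_pow{,_pow}_sub_one_le{,_mul}`, `isSlopeZeroAt_iff_norm_eq_one`, `slopeDichotomy`,
`not_isSlopeZeroAt_of_tendsto_zero`) and `…/Negative/FrobeniusIntegrality.lean` (p77221:
`hpm_point_integral`, `ord_point_integral`, `norm_trace_det_frob_le_one{,_of_isOrdinarilyPadicallyAutomorphic}`,
`trace_det_frob_of_isAssociatedFamily`, `eventually_isUnramifiedAt_of_is{Ordinarily,Iwahori}PadicallyAutomorphic`,
`heckeFrobPoly_two_eisenstein`); §5–§7 below keep their cycle-2 statements (now one-line consequences).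
Also imported (sibling crux, p75392):
`Theorems/EisensteinProModularSeed/Negative/BorelAndEisenstein.lean`
(`not_isIrreducible_of_conj_upperTriangular`, `trace_det_frob_of_isAssociated`).
-/

set_option linter.dupNamespace false

namespace Summit.Langlands.Langlands.Cruxes.ProModularOrdinaryClassical.Disproof

open Summit.Langlands.Langlands.Theses.SkinnerWilesDefectOne
open Summit.Langlands.Langlands.Theorems.ProModularOrdinaryClassical.Negative
open Summit.Langlands.Langlands.Theorems.EisensteinProModularSeed.Negative
  (not_isIrreducible_of_conj_upperTriangular trace_det_frob_of_isAssociated)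
open Summit.Langlands.Langlands.Theorems.ReducibleOrdinaryProModular.Negative (heckeFrobPoly_two)
open Literature.NumberTheory.Automorphic Literature.NumberTheory.GaloisRepresentations
open Literature.NumberTheory.Automorphic.BigHeckeGLn
open NumberField IsDedekindDomain Filter Topology Polynomial

/-! ## §0 Position of the crux: Fontaine–Mazur (B), ordinary parallel-weight sector -/

/-- **Fontaine–Mazur–Langlands (B) in the ordinary parallel-weight sector over imaginary quadratic
fields**: the crux with the pro-modularity hypothesis `∃ 𝒰, 𝒰.IsPadicallyAutomorphic ρ` DELETED.
Every hypothesis kept is a hypothesis of the summit's conjunct (B) (`ρ` irreducible, unramified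
a.e.; ordinary of weight `k ≥ 2` at `v ∣ p` ⇒ potentially semistable there, HT weights
`{0, k-1}`), and the conclusion is the first clause of `Corresponds`. OPEN (known sub-cases:
none covering residually reducible or small-image `ρ̄` over CM fields). [folklore] -/
def OrdinaryFontaineMazur : Prop :=
  ∀ (F : Type) [Field F] [NumberField F], IsTotallyComplex F → Module.finrank ℚ F = 2 →
    ∀ (p : ℕ) [Fact p.Prime], p ≠ 2 →
    ∀ (hcpt : isCompact_glFiniteIntegralLevel 2 F) (ι : PadicAlgCl p ≃+* ℂ)
      (ρ : FramedGaloisRep F (PadicAlgCl p) 2),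
      ρ.toGaloisRep.IsIrreducible → (∀ᶠ v in cofinite, ρ.IsUnramifiedAt v) →
      (∃ k : ℕ, 2 ≤ k ∧ ∃ m : ℕ, 0 < m ∧ ∀ v : HeightOneSpectrum (𝓞 F),
          (p : 𝓞 F) ∈ v.asIdeal → ρ.IsOrdinaryOfWeightAt p v k m) →
      ∃ π : CuspidalAutomorphicRepData 2 F hcpt, π.1.IsLAlgebraic ∧
        ∀ᶠ v in cofinite, Summit.Langlands.SatakeFrobCompatibleAt ι π.1 ρ v

/-- **The crux is implied by FM in its sector**: deleting the pro-modularity hypothesis gives a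
statement that implies the crux verbatim. Consequently (i) any refutation of the crux refutes
Fontaine–Mazur–Langlands (B) for `GL₂` over an imaginary quadratic field in the ordinary
parallel-weight sector, and (ii) a proof of the crux that does not use `hpm` proves FM there —
the pro-modularity hypothesis is the ONLY lever separating the crux from the open conjecture.
[folklore] -/
theorem crux_of_ordinaryFontaineMazur (h : OrdinaryFontaineMazur) : ProModularOrdinaryClassical :=
  fun F _ _ hF hdeg p _ hp hcpt ι ρ hirr hunr _hpm hord => h F hF hdeg p hp hcpt ι ρ hirr hunr hord

/-- **Crux ⇐ summit (B) + the ordinary ⇒ de Rham bridge.** If for every imaginary quadratic `F`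
and every `hcpt` there are reciprocity data `𝓡` satisfying (B) for `n = 2` and for which every
a.e.-unramified `ρ : Γ_F → GL₂(ℚ̄_p)` ordinary of a parallel weight `k ≥ 2` at all `v ∣ p` is
`𝓡`-geometric (the de Rham clause w.r.t. the placeholder datum `𝓡.pst`; mathematically:
ordinary of weight `k ≥ 2` ⇒ potentially semistable, `H¹_g = H¹` for `ε^{k-1}χ`, `k - 1 ≥ 1`),
then the crux holds — irreducibility and pro-modularity are not even needed for this reduction
beyond what (B) asks. [folklore] -/
theorem crux_of_summitB
    (h : ∀ (F : Type) [Field F] [NumberField F], IsTotallyComplex F → Module.finrank ℚ F = 2 →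
      ∀ (hcpt : isCompact_glFiniteIntegralLevel 2 F), ∃ 𝓡 : Summit.Langlands.ReciprocityData F,
        Summit.Langlands.GaloisToAutomorphic 2 𝓡 hcpt ∧
        ∀ (p : ℕ) [Fact p.Prime] (ρ : FramedGaloisRep F (PadicAlgCl p) 2),
          (∀ᶠ v in cofinite, ρ.IsUnramifiedAt v) →
          (∃ k : ℕ, 2 ≤ k ∧ ∃ m : ℕ, 0 < m ∧ ∀ v : HeightOneSpectrum (𝓞 F),
              (p : 𝓞 F) ∈ v.asIdeal → ρ.IsOrdinaryOfWeightAt p v k m) →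
          Summit.Langlands.IsGeometricFramed 𝓡 ρ) :
    ProModularOrdinaryClassical := by
  intro F _ _ hF hdeg p _ _hp hcpt ι ρ hirr hunr _hpm hord
  obtain ⟨𝓡, hB, hgeom⟩ := h F hF hdeg hcpt
  exact satakeConclusion_of_galoisToAutomorphic hcpt 𝓡 hB ι ρ hirr (hgeom p ρ hunr hord)

/-! ## §1 Load-bearing analysis -/

/-! ### §1a  The a.e.-unramified hypothesis is implied by pro-modularity -/

/-- The crux with the a.e.-unramified hypothesis DROPPED. [folklore] -/
def WithoutUnramified : Prop :=
  ∀ (F : Type) [Field F] [NumberField F], IsTotallyComplex F → Module.finrank ℚ F = 2 →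
    ∀ (p : ℕ) [Fact p.Prime], p ≠ 2 →
    ∀ (hcpt : isCompact_glFiniteIntegralLevel 2 F) (ι : PadicAlgCl p ≃+* ℂ)
      (ρ : FramedGaloisRep F (PadicAlgCl p) 2),
      ρ.toGaloisRep.IsIrreducible →
      (∃ 𝒰 : TameLevel 2 F p, 𝒰.IsPadicallyAutomorphic ρ) →
      (∃ k : ℕ, 2 ≤ k ∧ ∃ m : ℕ, 0 < m ∧ ∀ v : HeightOneSpectrum (𝓞 F),
          (p : 𝓞 F) ∈ v.asIdeal → ρ.IsOrdinaryOfWeightAt p v k m) →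
      ∃ π : CuspidalAutomorphicRepData 2 F hcpt, π.1.IsLAlgebraic ∧
        ∀ᶠ v in cofinite, Summit.Langlands.SatakeFrobCompatibleAt ι π.1 ρ v

/-- **`hunr` is decoration**: the crux is EQUIVALENT to its version without the a.e.-unramified
hypothesis. (No `_false_without_` theorem: dropping it changes nothing.) [folklore] -/
theorem crux_iff_withoutUnramified : ProModularOrdinaryClassical ↔ WithoutUnramified := by
  constructor
  · intro h F _ _ hF hdeg p _ hp hcpt ι ρ hirr hpm hord
    obtain ⟨𝒰, h𝒰⟩ := hpm
    exact h F hF hdeg p hp hcpt ι ρ hirr (eventually_isUnramifiedAt_of_isPadicallyAutomorphic 𝒰 h𝒰)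
      ⟨𝒰, h𝒰⟩ hord
  · intro h F _ _ hF hdeg p _ hp hcpt ι ρ hirr _hunr hpm hord
    exact h F hF hdeg p hp hcpt ι ρ hirr hpm hord

/-! ### §1b  The uniform inertial exponent is not a restriction -/

/-- The crux with PER-PLACE inertial exponents (`∀ v ∣ p, ∃ m_v > 0`). [folklore] -/
def WithPerPlaceExponent : Prop :=
  ∀ (F : Type) [Field F] [NumberField F], IsTotallyComplex F → Module.finrank ℚ F = 2 →
    ∀ (p : ℕ) [Fact p.Prime], p ≠ 2 →
    ∀ (hcpt : isCompact_glFiniteIntegralLevel 2 F) (ι : PadicAlgCl p ≃+* ℂ)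
      (ρ : FramedGaloisRep F (PadicAlgCl p) 2),
      ρ.toGaloisRep.IsIrreducible → (∀ᶠ v in cofinite, ρ.IsUnramifiedAt v) →
      (∃ 𝒰 : TameLevel 2 F p, 𝒰.IsPadicallyAutomorphic ρ) →
      (∃ k : ℕ, 2 ≤ k ∧ ∀ v : HeightOneSpectrum (𝓞 F), (p : 𝓞 F) ∈ v.asIdeal →
          ∃ m : ℕ, 0 < m ∧ ρ.IsOrdinaryOfWeightAt p v k m) →
      ∃ π : CuspidalAutomorphicRepData 2 F hcpt, π.1.IsLAlgebraic ∧
        ∀ᶠ v in cofinite, Summit.Langlands.SatakeFrobCompatibleAt ι π.1 ρ v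

/-- **The uniform `m` is equivalent to per-place exponents** (so neither a weakening nor a
strengthening is available along this axis). [folklore] -/
theorem crux_iff_perPlaceExponent : ProModularOrdinaryClassical ↔ WithPerPlaceExponent := by
  constructor
  · intro h F _ _ hF hdeg p _ hp hcpt ι ρ hirr hunr hpm hord
    obtain ⟨k, hk, hv⟩ := hord
    exact h F hF hdeg p hp hcpt ι ρ hirr hunr hpm ⟨k, hk, (exists_uniform_exponent ρ k).1 hv⟩
  · intro h F _ _ hF hdeg p _ hp hcpt ι ρ hirr hunr hpm hord
    obtain ⟨k, hk, hm⟩ := hord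
    exact h F hF hdeg p hp hcpt ι ρ hirr hunr hpm ⟨k, hk, (exists_uniform_exponent ρ k).2 hm⟩

/-! ### §1c  `0 < m` is load-bearing: with `m = 0` the weight disappears -/

/-- The crux with the side condition `0 < m` DROPPED (so `m = 0` is allowed). By
`isOrdinaryOfWeight_exponent_zero_iff` its local hypothesis at `m = 0` is "`ρ|Γ_{F_v}`
upper-triangularisable" and the weight `k` is vacuous. Morally FALSE (dense non-classical points of
nearly ordinary families over `F`, Hida; Calegari–Mazur 2009); a Lean witness needs an explicit
non-classical pro-modular `ρ`, out of reach of the present library. [folklore] -/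
def WithExponentZero : Prop :=
  ∀ (F : Type) [Field F] [NumberField F], IsTotallyComplex F → Module.finrank ℚ F = 2 →
    ∀ (p : ℕ) [Fact p.Prime], p ≠ 2 →
    ∀ (hcpt : isCompact_glFiniteIntegralLevel 2 F) (ι : PadicAlgCl p ≃+* ℂ)
      (ρ : FramedGaloisRep F (PadicAlgCl p) 2),
      ρ.toGaloisRep.IsIrreducible → (∀ᶠ v in cofinite, ρ.IsUnramifiedAt v) →
      (∃ 𝒰 : TameLevel 2 F p, 𝒰.IsPadicallyAutomorphic ρ) →
      (∃ k : ℕ, 2 ≤ k ∧ ∃ m : ℕ, ∀ v : HeightOneSpectrum (𝓞 F),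
          (p : 𝓞 F) ∈ v.asIdeal → ρ.IsOrdinaryOfWeightAt p v k m) →
      ∃ π : CuspidalAutomorphicRepData 2 F hcpt, π.1.IsLAlgebraic ∧
        ∀ᶠ v in cofinite, Summit.Langlands.SatakeFrobCompatibleAt ι π.1 ρ v

/-- `WithExponentZero` is a genuine strengthening: it implies the crux. [folklore] -/
theorem crux_of_withExponentZero (h : WithExponentZero) : ProModularOrdinaryClassical :=
  fun F _ _ hF hdeg p _ hp hcpt ι ρ hirr hunr hpm ⟨k, hk, m, _, hm⟩ =>
    h F hF hdeg p hp hcpt ι ρ hirr hunr hpm ⟨k, hk, m, hm⟩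

/-- **What `WithExponentZero` really says**: it contains the weight-free statement "irreducible +
pro-modular + upper-triangularisable at every `v ∣ p` ⇒ classical L-algebraic cuspidal" (take
`k = 2`, `m = 0`). This is the precise over-claim that `0 < m` removes. [folklore] -/
theorem locallyReducible_classical_of_withExponentZero (h : WithExponentZero)
    (F : Type) [Field F] [NumberField F] (hF : IsTotallyComplex F) (hdeg : Module.finrank ℚ F = 2)
    (p : ℕ) [Fact p.Prime] (hp : p ≠ 2) (hcpt : isCompact_glFiniteIntegralLevel 2 F)
    (ι : PadicAlgCl p ≃+* ℂ) (ρ : FramedGaloisRep F (PadicAlgCl p) 2)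
    (hirr : ρ.toGaloisRep.IsIrreducible) (hunr : ∀ᶠ v in cofinite, ρ.IsUnramifiedAt v)
    (hpm : ∃ 𝒰 : TameLevel 2 F p, 𝒰.IsPadicallyAutomorphic ρ)
    (htri : ∀ v : HeightOneSpectrum (𝓞 F), (p : 𝓞 F) ∈ v.asIdeal →
      ∃ Q : GL (Fin 2) (PadicAlgCl p), ∀ σ, (Q⁻¹ * ρ.toLocal v σ * Q).val 1 0 = 0) :
    ∃ π : CuspidalAutomorphicRepData 2 F hcpt, π.1.IsLAlgebraic ∧
      ∀ᶠ v in cofinite, Summit.Langlands.SatakeFrobCompatibleAt ι π.1 ρ v :=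
  h F hF hdeg p hp hcpt ι ρ hirr hunr hpm ⟨2, le_rfl, 0, fun v hv =>
    (isOrdinaryOfWeight_exponent_zero_iff p (ρ.toLocal v) 2).2 (htri v hv)⟩

/-! ### §1d  `2 ≤ k`: see `isOrdinaryOfWeight_weight_zero_iff_one` (landed) — `k = 0` is
ℕ-subtraction junk for `k = 1`; the `k ≤ 1` slice is Artin-type (FM ⇒ finite image), still
predicted automorphic, so `2 ≤ k` is load-bearing for the Hida-theoretic METHOD, not for truth. -/

/-! ### §1e  Irreducibility (def only — see the findings index for why no theorem) -/

/-- The crux with IRREDUCIBILITY DROPPED. Morally false: the degree-`0` Eisenstein eigensystem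
(`T_{v,1} ↦ q_v + 1`, `T_{v,2} ↦ 1` on the constant functions in `H⁰(X_{U_r}, ℤ/p^s)`, all
`r, s`) is a continuous `ℤ_p`-point of `𝕋(𝒰)` associated with `ρ = ε ⊕ 1`
(`heckeFrobPoly 2 q (q+1, 1) = X² - (q+1)X + q = (X - q)(X - 1)`, arithmetic Frobenius), which
is unramified away from `p` (`FramedGaloisRep.isUnramifiedAt_cyclotomic_holds`) and ordinary of
weight `2`, exponent `1`, frame `Q = 1`; and no cuspidal `π` on `GL₂(𝔸_F)` has Satake parameters
`{1, q_v⁻¹}`-type at almost all `v` (Jacquet–Shalika / strong multiplicity one with the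
Eisenstein spectrum). A Lean proof needs (i) the Hecke action on `H⁰` of the constructed tower made
explicit and (ii) Jacquet–Shalika — both absent. [folklore] -/
def WithoutIrreducible : Prop :=
  ∀ (F : Type) [Field F] [NumberField F], IsTotallyComplex F → Module.finrank ℚ F = 2 →
    ∀ (p : ℕ) [Fact p.Prime], p ≠ 2 →
    ∀ (hcpt : isCompact_glFiniteIntegralLevel 2 F) (ι : PadicAlgCl p ≃+* ℂ)
      (ρ : FramedGaloisRep F (PadicAlgCl p) 2),
      (∀ᶠ v in cofinite, ρ.IsUnramifiedAt v) →
      (∃ 𝒰 : TameLevel 2 F p, 𝒰.IsPadicallyAutomorphic ρ) →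
      (∃ k : ℕ, 2 ≤ k ∧ ∃ m : ℕ, 0 < m ∧ ∀ v : HeightOneSpectrum (𝓞 F),
          (p : 𝓞 F) ∈ v.asIdeal → ρ.IsOrdinaryOfWeightAt p v k m) →
      ∃ π : CuspidalAutomorphicRepData 2 F hcpt, π.1.IsLAlgebraic ∧
        ∀ᶠ v in cofinite, Summit.Langlands.SatakeFrobCompatibleAt ι π.1 ρ v

/-- `WithoutIrreducible` is a strengthening of the crux. [folklore] -/
theorem crux_of_withoutIrreducible (h : WithoutIrreducible) : ProModularOrdinaryClassical :=
  fun F _ _ hF hdeg p _ hp hcpt ι ρ _hirr hunr hpm hord => h F hF hdeg p hp hcpt ι ρ hunr hpm hord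

/-! ### §1f (gen 2)  Ordinarity at EVERY place above `p` is load-bearing — with an honest witness

The first variant whose falsity does NOT route through ¬Fontaine–Mazur. -/

/-- The crux with ordinarity required at SOME place above `p` only (`∃ v ∣ p` instead of `∀ v ∣ p`;
relevant when `p` splits, `(p) = v v̄`). FALSE ON PAPER by an explicit, elementary TWIST construction
(not Lean-constructible today: it needs one classical pro-modular `ρ₀` and the twisting operation on the
tower's cohomology, neither in the tree). Take `p` split in `F` and ANY `ρ₀` meeting the crux's
hypotheses — e.g. `F = ℚ(i)`, `p = 5 = v v̄`, `ρ₀ = T₅(11a1)|_{Γ_F}` (ordinary at `5`, `a₅ = 1`;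
irreducible over `ℚ(i)`), pro-modular of weight `2`. By class field theory (`𝒪_{v̄}^× ≅ ℤ_5^×`,
global units `{±1, ±i}` finite, `h_F = 1`) there is a continuous character `χ_t : Γ_F → 1 + 5ℤ_5`
ramified ONLY at `v̄`, `χ_t ∘ Art_{v̄} = (x ↦ ⟨x⟩^t)` on `𝒪_{v̄}^×`, for every `t ∈ ℤ_5`. Put
`ρ_t := ρ₀ ⊗ χ_t`: irreducible, unramified outside `{11, v, v̄}`, ORDINARY OF WEIGHT `2` AT `v` for
every `t` (`χ_t` is unramified at `v`, so the inertial clauses at `v` are untouched), and pro-modular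
(see the end of this docstring); at `v̄` its inertial characters are `ε·⟨·⟩^t, ⟨·⟩^t`: for `t ∉ ℤ`
not of any arithmetic weight, not de Rham. Choose `t` with `2t ∉ ℤ`, so that `χ_t²` is NOT locally
algebraic at `v̄`. If an L-algebraic cuspidal `π` matched `ρ_t` through `ι` at almost all places, its central character
`ω_π` would be an ALGEBRAIC Hecke character (type `A₀`: the exponents of an L-algebraic `π_∞` are
integers), and the determinant shadow (`exists_heckeCharacter_of_satakeConclusion`, landed) gives
`ω_π(ϖ_w) = ι(det ρ_t(Frob_w))⁻¹` for almost all `w`; by Chebotarev `det ρ_t` is then the `p`-adic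
avatar (Weil) of the algebraic character `ω_π⁻¹`, hence locally algebraic at `v̄` — contradicting
`det ρ_t = det ρ₀ · χ_t²` with `det ρ₀` locally algebraic and `χ_t²` not. So the conclusion fails for
`ρ_t` for EVERY `ι`, through the central character alone (locally algebraic twists `χ`, by contrast,
give `ρ₀ ⊗ χ` automorphic — `π₀ ⊗ (χ∘det)` — and are no witnesses: non-algebraicity is essential).
In the crux, ordinarity at ALL `v ∣ p` makes `det ρ|_{I_v}` locally algebraic everywhere and closes
this door; so "`∀ v ∣ p`" in H4 is load-bearing, witnessed by honest
pro-modular points (not by an FM-counterexample). The formal half of the door is PROVED: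
`Negative/DeterminantShadow.lean` (p77771; `exists_heckeCharacter_of_satakeConclusion`: the conclusion
for `(ι, ρ)` yields a Hecke character `Ω : 𝕀_F →ₜ* ℂˣ`, continuous and trivial on `F^×` by
definition, with `Ω(ϖ_w) · ι(det ρ(Frob_w)) = 1` for almost all `w` — Borel–Jacquet central character);
the paper half is "L-algebraic ⇒ `ω_π` of type `A₀`" + Weil's `p`-adic avatars + Chebotarev. The same twist
(now allowed at BOTH places above `p`) is an equally honest witness against `WithExponentZero` (§1c):
with `m = 0` the inertial clauses are void, `ρ₀ ⊗ χ` stays upper-triangularisable at `v, v̄`,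
pro-modular and irreducible, and fails the determinant test. Pro-modularity of the twists: the function
`χ∘det` is locally constant mod `p^s` on `X_{U_r}` for `r ≫ s` (χ continuous, unramified outside `p`,
trivial on `F^×`), so cup product with it conjugates `T_{w,i}` into `χ(Frob_w)^i T_{w,i}` on
`H^•(X_{U_r}, ℤ/p^s)`: the twisted eigensystem occurs in completed cohomology at the same tame level.
[folklore] -/
def WithOrdinaryAtSomePlace : Prop :=
  ∀ (F : Type) [Field F] [NumberField F], IsTotallyComplex F → Module.finrank ℚ F = 2 →
    ∀ (p : ℕ) [Fact p.Prime], p ≠ 2 →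
    ∀ (hcpt : isCompact_glFiniteIntegralLevel 2 F) (ι : PadicAlgCl p ≃+* ℂ)
      (ρ : FramedGaloisRep F (PadicAlgCl p) 2),
      ρ.toGaloisRep.IsIrreducible → (∀ᶠ v in cofinite, ρ.IsUnramifiedAt v) →
      (∃ 𝒰 : TameLevel 2 F p, 𝒰.IsPadicallyAutomorphic ρ) →
      (∃ k : ℕ, 2 ≤ k ∧ ∃ m : ℕ, 0 < m ∧ ∃ v : HeightOneSpectrum (𝓞 F),
          (p : 𝓞 F) ∈ v.asIdeal ∧ ρ.IsOrdinaryOfWeightAt p v k m) →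
      ∃ π : CuspidalAutomorphicRepData 2 F hcpt, π.1.IsLAlgebraic ∧
        ∀ᶠ v in cofinite, Summit.Langlands.SatakeFrobCompatibleAt ι π.1 ρ v

/-- Every rational prime lies below some finite place of a number field (short copy of the tree's
`exists_heightOneSpectrum_natCast_mem` of `ReciprocityGLnPatchingFamily`, to avoid importing that cone
here). [folklore] -/
theorem exists_place_above (F : Type) [Field F] [NumberField F] (p : ℕ) [hp : Fact p.Prime] :
    ∃ v : HeightOneSpectrum (𝓞 F), (p : 𝓞 F) ∈ v.asIdeal := by
  have hp' : Prime (p : ℤ) := Nat.prime_iff_prime_int.mp hp.out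
  haveI : (Ideal.span {(p : ℤ)}).IsPrime := (Ideal.span_singleton_prime hp'.ne_zero).mpr hp'
  have hinj : Function.Injective (algebraMap ℤ (𝓞 F)) := (algebraMap ℤ (𝓞 F)).injective_int
  obtain ⟨Q, -, hQ, hQp⟩ := Ideal.exists_ideal_over_prime_of_isIntegral
    (S := 𝓞 F) (Ideal.span {(p : ℤ)}) ⊥
    (by
      rw [← RingHom.ker_eq_comap_bot, (RingHom.injective_iff_ker_eq_bot _).mp hinj]
      exact bot_le)
  have hmem : (p : ℤ) ∈ Q.comap (algebraMap ℤ (𝓞 F)) := by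
    rw [hQp]
    exact Ideal.mem_span_singleton_self _
  refine ⟨⟨Q, hQ, fun hQbot => hp'.ne_zero ?_⟩, ?_⟩
  · rw [hQbot, Ideal.mem_comap, Ideal.mem_bot, map_eq_zero_iff _ hinj] at hmem
    exact hmem
  · rw [Ideal.mem_comap, map_natCast] at hmem
    exact hmem

/-- `WithOrdinaryAtSomePlace` is a strengthening of the crux: it implies the crux verbatim (carry any
place above `p`, `exists_place_above`, from the crux's `∀ v ∣ p` hypothesis). So its paper witness
(docstring above) is exactly a witness that "`∀ v ∣ p`" cannot be weakened to "`∃ v ∣ p`". [folklore] -/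
theorem crux_of_withOrdinaryAtSomePlace (h : WithOrdinaryAtSomePlace) : ProModularOrdinaryClassical := by
  intro F _ _ hF hdeg p _ hp hcpt ι ρ hirr hunr hpm hord
  obtain ⟨k, hk, m, hm, hv⟩ := hord
  obtain ⟨v, hpv⟩ := exists_place_above F p
  exact h F hF hdeg p hp hcpt ι ρ hirr hunr hpm ⟨k, hk, m, hm, v, hpv, hv v hpv⟩

/-! ## §2 A natural strengthening that is NOT refutable either: non-parallel weights -/

/-- The crux with PER-PLACE weights `k_v ≥ 2` (non-parallel ordinary weight allowed at split `p`).
Not refutable short of ¬FM: an irreducible `ρ` ordinary of regular NON-parallel weight over the CM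
field `F` would be geometric, hence (FM) motivic and pure, and Clozel's purity lemma forces the
Hodge–Tate weights at conjugate embeddings to pair up to a constant — i.e. parallel up to twist,
which for the normalised shape `{0, k_v - 1}` means `k_v = k_{v̄}`; so FM predicts that the new
part of the hypothesis is never met (Calegari–Mazur 2009 prove finiteness of such specialisations
in families). Recorded so that nobody spends a cycle on it. [folklore] -/
def WithPerPlaceWeights : Prop :=
  ∀ (F : Type) [Field F] [NumberField F], IsTotallyComplex F → Module.finrank ℚ F = 2 →
    ∀ (p : ℕ) [Fact p.Prime], p ≠ 2 →
    ∀ (hcpt : isCompact_glFiniteIntegralLevel 2 F) (ι : PadicAlgCl p ≃+* ℂ)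
      (ρ : FramedGaloisRep F (PadicAlgCl p) 2),
      ρ.toGaloisRep.IsIrreducible → (∀ᶠ v in cofinite, ρ.IsUnramifiedAt v) →
      (∃ 𝒰 : TameLevel 2 F p, 𝒰.IsPadicallyAutomorphic ρ) →
      (∀ v : HeightOneSpectrum (𝓞 F), (p : 𝓞 F) ∈ v.asIdeal →
          ∃ k : ℕ, 2 ≤ k ∧ ∃ m : ℕ, 0 < m ∧ ρ.IsOrdinaryOfWeightAt p v k m) →
      ∃ π : CuspidalAutomorphicRepData 2 F hcpt, π.1.IsLAlgebraic ∧
        ∀ᶠ v in cofinite, Summit.Langlands.SatakeFrobCompatibleAt ι π.1 ρ v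

/-- `WithPerPlaceWeights` is a strengthening of the crux. [folklore] -/
theorem crux_of_withPerPlaceWeights (h : WithPerPlaceWeights) : ProModularOrdinaryClassical :=
  fun F _ _ hF hdeg p _ hp hcpt ι ρ hirr hunr hpm ⟨k, hk, m, hm, hv⟩ =>
    h F hF hdeg p hp hcpt ι ρ hirr hunr hpm fun v hpv => ⟨k, hk, m, hm, hv v hpv⟩

/-! ## §3 Type-level non-vacuity -/

/-- The tame-level type is inhabited (full level `GL₂(𝒪̂_F)`, `S = {v ∣ p}`), so the
pro-modularity hypothesis is not vacuous for lack of levels. (Irreducible continuous `ρ` exist —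
e.g. induced from a character of a quadratic extension — but are not built here; a genuinely
pro-modular irreducible ordinary `ρ`, e.g. from an ordinary Bianchi newform, is far out of reach
of the library: no Galois representation is attached to any automorphic object in the tree.)
[folklore] -/
theorem tameLevel_nonempty (F : Type) [Field F] [NumberField F] (p : ℕ) [Fact p.Prime] :
    Nonempty (TameLevel 2 F p) :=
  ⟨TameLevel.full 2 F p⟩

/-! ## §4 Attack log (cycle 1) and WHY IT RESISTS

Attacks run (2026-08-16), cheapest first:
1. ELABORATION: `theorem probe : ProModularOrdinaryClassical := by sorry` — rc 0, axioms
   {propext, Classical.choice, Quot.sound}. Read-back: binders in the printed order; `k - 1` is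
   ℕ-subtraction but guarded by `2 ≤ k`; `m` uniform over `v ∣ p` (harmless, §1b); `hcpt`, `ι`
   are data of the conclusion's types; no `/`, no `Finset.sup`, no `tsum`.
2. VACUITY of hypotheses: `TameLevel` inhabited (§3); `IsPadicallyAutomorphic` is a genuine `∃`
   over continuous points of the CONSTRUCTED big Hecke algebra (closed subring of a product of
   `End(H^i(X_{U_r}, ℤ/p^s))`, `H^i` = `groupCohomology` of `GL₂(F)` on `Fun(GL₂(𝔸_F^∞)/U_r, -)`,
   Shapiro ⇒ Bianchi-group cohomology); `𝕋(𝒰) ≠ 0` (`H⁰ ∋` constants for `s ≥ 1`). No junk found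
   that makes the hypothesis free (then the crux would be literally FM) or impossible (then the
   crux would be vacuously provable).
3. TRIVIALITY of the conclusion: `CuspidalAutomorphicRepData` = Borel–Jacquet cusp-form data
   (non-unitary central characters allowed, so the L-algebraic twist `π_f ⊗ |det|^{(k-1)/2}` IS a
   datum); `HasSatakeParamAt` pins `card α = 2` and genuine Hecke eigenvalues; `HasFrobCharpolyAt`
   quantifies over Mathlib `IsArithFrobAt` at primes of `absIntegers` above `v` (non-vacuous for
   number fields). Not closable by `simp/aesop/exact?` (needs an actual `π`).
4. JUNK MODELS: degenerate `F` impossible (`finrank = 2`, totally complex ⇒ imaginary quadratic);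
   `p = 2` excluded; `n` fixed to `2`; `k ∈ {0,1}` excluded (§1d); `m = 0` excluded (§1c).
5. HYPOTHESIS MUTATION: §1a (`hunr` redundant, PROVED), §1b (`m` uniformity irrelevant, PROVED),
   §1c (`0 < m` load-bearing, degeneration PROVED, falsity moral), §1d (`2 ≤ k` method-only),
   §1e (irreducibility load-bearing, moral), `p ≠ 2` / imaginary quadratic (method-only).
6. STRENGTHENINGS: §2 (non-parallel) unrefutable short of ¬FM; "conclusion with `Corresponds` at
   all places" is the summit's shape and needs `𝓡` — not a crux variant.
7. LITERATURE (negatives): `ledger negatives --problem Langlands` — 1 entry (K3KugaSatake anchor,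
   unrelated); barrier catalogue `Literature/Barriers/Langlands/*` (9 files) — the two that touch
   this route (`ResiduallyReducibleBarrier`, `TaylorWilesNumericalCoincidence`) constrain PROOF
   TECHNIQUES for the engine crux, not the truth of the exit; `NonRegularWeightBarrier` does not
   bite (weights `{0, k-1}`, `k ≥ 2`, are regular). No printed counterexample to FM for `GL₂` over
   imaginary quadratic fields is known to this seat; the nearest negative phenomenon
   (Calegari–Mazur, *Nearly ordinary Galois deformations over arbitrary number fields*, JIMJ 2009:
   nearly ordinary families over imaginary quadratic fields with few classical points) concerns
   NON-arithmetic / non-parallel specialisations, which the crux's `0 < m` + single `k` exclude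
   (§1c, §2). Evidence FOR truth (from memory, pages not re-read this cycle — searchd rc 75,
   galaxy substring 0 hits, 2026-08-16T00:35Z–00:50Z, `search-degraded`): Hida's control theorems
   for nearly ordinary cohomology of `GL₂` over fields with complex places give classicality of
   AUTOMORPHICALLY-ordinary arithmetic-weight eigensystems up to bounded torsion; ordinary
   local–global compatibility at `p` for completed cohomology of locally symmetric spaces
   (Caraiani–Newton 2023) is proved under non-Eisenstein + decomposed-generic hypotheses — so the
   crux is a theorem-in-waiting on the generic locus and open exactly where the route needs it
   (Eisenstein `𝔪`), never contradicted.

WHY IT RESISTS: `crux_of_ordinaryFontaineMazur` — the crux is (B) ∩ {ordinary, parallel `k ≥ 2`}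
weakened by an extra hypothesis; every candidate witness (irreducible, pro-modular, ordinary, not
classical) is a counterexample to Fontaine–Mazur–Langlands over a CM field. The formal loopholes
that killed other Langlands cruxes (vacuous index sets, junk at `n = 0`, missing primality) are
absent: all parameters are pinned (`n = 2`, `[F:ℚ] = 2`, `p` prime `≠ 2`, `k ≥ 2`, `m ≥ 1`).

NEXT REGIMES (cycle 2, if re-armed with stubs): attack the lead's `OrdinaryFactorisation` /
`HidaControlGL2F` stubs when filed — THOSE are refutable in principle (torsion in `H²` of Bianchi
groups breaks naive control; Eisenstein-localised completed cohomology lacks ordinary local–global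
compatibility), unlike the crux.
-/

/-! ## §5 (gen 2, cycle 2) Type-level non-vacuity completed; interface audit

Every binder of the crux is inhabited at type level: `F` (imaginary quadratic fields exist),
`p` (odd primes), `hcpt` (`hcpt_holds`), `ι` (`iota_nonempty` — needs choice: Steinitz), `ρ`
(e.g. `1 ⊕ ε`, reducible; irreducible continuous `ρ` exist, not built), `𝒰` (`tameLevel_nonempty`).
So the crux is not provable "for free" by an empty `Π`-type, and not refutable by a junk one.

Interface audit (readings, recorded for the provers; nothing here is junk):
* `absInertia K_v = (absMaximalIdeal K_v).inertia Γ_{K_v}`, `absMaximalIdeal = rad(𝓂_v S)` — the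
  genuine inertia group (no parameter, no sorried datum inside the DEFINITION); the inertial clauses
  of `IsOrdinaryOfWeight` are therefore the printed ones.
* `GaloisRep.cyclotomicCharacter K_v p` is Mathlib's cyclotomic character of `Gal(K̄_v/K_v)`
  (all `p`-power roots of unity exist in `AlgebraicClosure K_v`, char `0`); its compatibility with
  `absGaloisRestrict` is the tree's `cyclotomicCharacter_absGaloisRestrict`.
* ORIENTATION of `IsOrdinaryOfWeight`: entry `(1,0) = 0` = upper triangular, the STABLE line is
  `Q e₀` with character `θ₁ = (·)₀₀`, required to be `ε^{k-1}·`(finite on `I_v`); the QUOTIENT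
  character `θ₂` is finite on `I_v`. This is the geometric ("sub is cyclotomic") orientation: the
  extension class lives in `H¹(G_v, ε^{k-1}ψ)`, all of which is potentially semistable for `k ≥ 2`.
  The OPPOSITE orientation (finite sub, cyclotomic quotient) would put the class in
  `H¹(G_v, ε^{1-k}ψ)`, where `H¹_g = 0`: non-split such `ρ` are NOT de Rham, fall outside
  Fontaine–Mazur, and a crux typed that way would be morally FALSE (non-classical points). The typed
  crux has the right orientation; split `ρ|_{D_v}` (CM at split `p`, critical Eisenstein) is ordinary
  in both readings, consistently.
* `heckeFrobPoly 2 q a = X² − a₁X + q a₂` (`heckeFrobPoly_two`, landed by the engine's disprover);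
  at the degree-`0` (Eisenstein) eigensystem `a = (q+1, 1)` it is `(X-1)(X-q)`
  (`heckeFrobPoly_two_eisenstein`): the arithmetic-Frobenius polynomial of `1 ⊕ ε` (`ε(Frob_v) = q_v`),
  as claimed in §1e; and a `ρ` that is upper triangular in one global frame is reducible
  (`not_isIrreducible_of_borelFrame`, from the seed's disprover) — the formal half of "irreducibility
  excludes the Eisenstein point".
* Ordinary side (`OrdinaryCompletedCohomologyGL`, used by every surviving line): `ordinaryPart` cuts by
  `U_{v,j}`, `1 ≤ j ≤ n-1` — for `n = 2` the single operator `U_{v,1}`; `ordT w j`/`hidaT w j` have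
  junk value `0` only OFF the Hida places, and `IsOrdAssociated` quantifies over `w ∉ bad`, which are
  Hida places: no junk `0` enters an association; `IsSlopeZeroAt x v` for `n = 2` is the single
  condition `x(U_{v,1})^{m!} → 1`.
-/

section NonVacuity

/-- **`ι` exists**: the crux's binder `ι : ℚ̄_p ≃+* ℂ` is inhabited (Steinitz: both fields are
algebraically closed of characteristic `0` and cardinality `𝔠`; tree lemma
`PadicAlgCl.nonempty_ringEquiv_complex`). Without this the crux — and the summit's (A), (B) —
would be vacuously provable in `ι`. [folklore] -/
theorem iota_nonempty (p : ℕ) [Fact p.Prime] : Nonempty (PadicAlgCl p ≃+* ℂ) :=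
  PadicAlgCl.nonempty_ringEquiv_complex p

/-- **`hcpt` exists**: the compactness datum typing the conclusion's `CuspidalAutomorphicRepData` is
a PROVED proposition (`isCompact_glFiniteIntegralLevel_holds`), so the binder `hcpt` is inhabited
(and proof-irrelevant). [folklore] -/
theorem hcpt_holds (F : Type) [Field F] [NumberField F] : isCompact_glFiniteIntegralLevel 2 F :=
  isCompact_glFiniteIntegralLevel_holds 2 F

/-- **The Eisenstein Hecke–Frobenius polynomial** (LANDED as `Negative.heckeFrobPoly_two_eisenstein`,
`Negative/FrobeniusIntegrality.lean`, p77221; the v4 local copy is now an `example` of the import). At the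
degree-`0` eigensystem `T_{v,1} ↦ q_v + 1`, `T_{v,2} ↦ 1` (constants in `H⁰(X_{U_r}, ℤ/p^s)`), the
polynomial of `IsAssociated` is `X² − (q+1)X + q = (X − 1)(X − q)`: the characteristic polynomial of the
ARITHMETIC Frobenius on `1 ⊕ ε` (`ε(Frob_v) = q_v`). This is the normalisation check behind §1e.
[folklore] -/
example {R : Type*} [CommRing R] (q : ℕ) (a : ℕ → R) (h1 : a 1 = q + 1) (h2 : a 2 = 1) :
    heckeFrobPoly 2 q a = (X - 1) * (X - C (q : R)) :=
  heckeFrobPoly_two_eisenstein q a h1 h2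

/-- **Borel-framed `ρ` are reducible** (re-export of the seed disprover's
`not_isIrreducible_of_conj_upperTriangular` at the crux's types): a `ρ : Γ_F → GL₂(ℚ̄_p)` that is
upper triangular in ONE global frame `P` — every `χ₁ ⊕ χ₂`, `1 ⊕ ε`, every extension
`(χ₁ ∗; 0 χ₂)`, i.e. every representation an Eisenstein point of `𝕋(𝒰)` can be associated with —
violates the crux's hypothesis H1. So H1 is exactly what fences off the `H⁰` points of §1e.
[folklore] -/
theorem not_isIrreducible_of_borelFrame {F : Type} [Field F] [NumberField F] {p : ℕ} [Fact p.Prime]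
    (ρ : FramedGaloisRep F (PadicAlgCl p) 2) (P : GL (Fin 2) (PadicAlgCl p))
    (h : ∀ σ, (P⁻¹ * ρ σ * P).val 1 0 = 0) : ¬ ρ.toGaloisRep.IsIrreducible :=
  not_isIrreducible_of_conj_upperTriangular ρ P h

end NonVacuity

/-! ## §6 (gen 2, cycle 2) Integrality of pro-modular eigensystems and of Frobenius data

From the landed `Negative/PointsIntegral.lean`: a continuous `x : 𝕋(𝒰) →+* ℚ̄_p` has `‖x t‖ ≤ 1`
for all `t`. Consequences at the crux's types. (What this does NOT do: distinguish classical from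
non-classical points — integrality holds for all of them, as it must: the crux is FM-hard, §0.)
-/

section Integrality

variable {F : Type} [Field F] [NumberField F] {p : ℕ} [Fact p.Prime]

/-- **H3 yields an INTEGRAL continuous eigensystem** (LANDED as `Negative.hpm_point_integral`,
`Negative/FrobeniusIntegrality.lean`, p77221): from `∃ 𝒰, 𝒰.IsPadicallyAutomorphic ρ` one gets a tame
level, a continuous `x : 𝕋(𝒰) → ℚ̄_p` associated with `ρ`, and `‖x t‖ ≤ 1` for every `t ∈ 𝕋(𝒰)`
(`norm_apply_le_one_of_continuous`). Any rank `n`. [folklore] -/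
example {n : ℕ} {ρ : FramedGaloisRep F (PadicAlgCl p) n}
    (hpm : ∃ 𝒰 : TameLevel n F p, 𝒰.IsPadicallyAutomorphic ρ) :
    ∃ (𝒰 : TameLevel n F p) (x : CompletedCohomologyHeckeAlgebraGLn 𝒰 →+* PadicAlgCl p),
      Continuous x ∧ 𝒰.IsAssociated x ρ ∧ ∀ t, ‖x t‖ ≤ 1 :=
  hpm_point_integral hpm

/-- **Frobenius traces and determinants of a pro-modular `ρ` are integral**: if `ρ : Γ_F → GL₂(ℚ̄_p)`
is `p`-adically automorphic of tame level `𝒰`, then at every good place `v ∉ 𝒰.bad` and every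
arithmetic Frobenius `σ` at a prime above `v`, `‖tr ρ(σ)‖ ≤ 1` and `‖det ρ(σ)‖ ≤ 1`
(`tr = x(T_{v,1})`, `det = q_v x(T_{v,2})`, `trace_det_frob_of_isAssociated`, integrality of `x`,
`‖q_v‖ ≤ 1`). (For a CONTINUOUS `ρ` this is also a consequence of compactness of `Γ_F`; the point
is that it is forced on the Hecke side alone, so no "non-integral junk point" of `𝕋(𝒰)` can ever be
associated with anything.) LANDED as `Negative.norm_trace_det_frob_le_one` (p77221). [folklore] -/
example {𝒰 : TameLevel 2 F p} {ρ : FramedGaloisRep F (PadicAlgCl p) 2}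
    (h : 𝒰.IsPadicallyAutomorphic ρ) {v : HeightOneSpectrum (𝓞 F)} (hv : v ∉ 𝒰.bad)
    {𝔓 : Ideal (absIntegers (𝓞 F) F)} (h𝔓 : 𝔓 ∈ v.primesAbove) {σ : Field.absoluteGaloisGroup F}
    (hσ : IsArithFrobAt (𝓞 F) σ 𝔓) :
    ‖(ρ σ).val.trace‖ ≤ 1 ∧ ‖(ρ σ).val.det‖ ≤ 1 :=
  norm_trace_det_frob_le_one h hv h𝔓 hσ

end Integrality

/-! ## §7 (gen 2, cycle 2) Pre-attack on the presumptive stubs of the round-1 lines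

No line is picked yet (`PICKED.md` absent), so there are no `-- Targets`; but five cards passed triage
(`paskunas-centre-split ≈ split-prime-paskunas-fibre`, `top-degree-exact-control`,
`ordinary-patching-by-regime`, `reducibility-ideal-elliptic-units`) and their typed first lemmas are
known (`Ideas/*.md`): `OrdinaryFactorisation(Split)`, `OrdinaryPointsClassical` /
`ClassicalOfOrdinaryPoint`, `SlopeDichotomy`, `BianchiHeckeDeterminant`. Findings, cheapest first.

**(S1) `SlopeDichotomy` is valuation theory** (`slopeDichotomy_norm` below, from the landed
`norm_hidaT_eq_one_or_lt_one`): for EVERY continuous `ℚ̄_p`-point of `𝕋^S(𝒰; p)`, at every place and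
index, `‖x(T_{w,j})‖ = 1` or (`‖x(T_{w,j})‖ < 1` and `x(T_{w,j})^{m!} → 0`). The card's phrasing with
`IsSlopeZeroAt` (`x(U_{v,1})^{m!} → 1`) differs from the unit branch `‖x(U_{v,1})‖ = 1` only by
`UnitBranch` (`‖u‖ = 1 ⇒ u^{m!} → 1` in `ℚ̄_p`), which is now PROVED (`unitBranch_holds`, from the landed
`Negative/SlopeDichotomy.lean`: compactness pigeonhole in the proper `ℚ_p`-space `ℚ_p(u)` for
`‖u^M − 1‖ < 1`, then `‖(1+z)^{p^k} − 1‖ ≤ max(‖p‖,‖z‖)^k`). So the card's stub holds VERBATIM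
(`slopeDichotomy`) and `IsSlopeZeroAt x v ↔ ‖x(U_{v,1})‖ = 1` (`isSlopeZeroAt_iff_norm_eq_one`).
RECOMMENDATION to the lead: import `Negative/SlopeDichotomy.lean`; do not file `SlopeDichotomy` as a
stub — it carries no prover time and no automorphic content.

**(S2) The typed split hypothesis admits ramified `p`.** `OrdinaryFactorisationSplit`
(card `paskunas-centre-split`) renders "`p` splits in `F`" as `SplitHypothesisAsTyped F p`
(`∀ v ∣ p, N v = p`). For `p` RAMIFIED in `F` (`(p) = v²`) one also has `N v = p`, so the typed
statement covers every ramified `p ≥ 5` (infinitely many `F` for each `p`), where `F_v/ℚ_p` is a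
ramified quadratic extension, `GL₂(F_v) ≠ GL₂(ℚ_p)`, and the card's own lever (Paškūnas blocks /
centre of `GL₂(ℚ_p)`-representations) does not exist — no classification of supersingular
representations of `GL₂(F_v)` for any `F_v ≠ ℚ_p`; cf. `Literature.Barriers.Langlands.ModPLanglandsGL2BeyondQp`
(whose catalogued scope is `f ≥ 2`: the ramified quadratic case `e = 2, f = 1` is not even covered by
the barrier's printed sources, so nothing positive is known there either). The statement remains
PREDICTED (FM), but the LINE cannot prove it there. Corrected hypothesis: `SplitsCompletelyAt F p`
below (add "`v²` does not divide `(p)`", equivalently two distinct places above `p`).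

**(S3) `OrdinaryPointsClassical` still contains a Galois ⇒ Hecke statement** (the
`top-degree-exact-control` card flags this itself as its "residual gap"; recorded here so that no
skeleton treats the second factor as Hida-control-only). Its hypotheses are
"`ρ` associated with a continuous point `x` of `𝕋^{S,ord}(𝒰)`" and "`ρ` Galois-ordinary of weight
`k`"; its intended proof (Hida control in weight `k` + Eichler–Shimura–Harder) needs `x` to be an
ARITHMETIC point OF WEIGHT `k` of the `Λ`-algebra, i.e. `x ∘ ordDiamondHom_v = ` (weight-`k`
algebraic character) · (finite order). `IsOrdAssociated` constrains only `x(T_{w,j})`, `w ∉ S` — it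
says nothing about the diamond operators. Reading the `Λ`-weight of `x` off `ρ|_{I_v}` (`θ₂|_{I_v}`
finite, `θ₁|_{I_v} = ε^{k-1}·`finite) IS local–global compatibility at `p` for the diamond operators
(Wiles 1988 / Hida for `GL₂/ℚ` and totally real fields, Skinner–Wiles (3.2)); over an imaginary
quadratic field it is part of the same open problem as `OrdinaryFactorisation` (known on the
classical locus; for Hida families over `F` see Hida 1994 AIF). So the split
`crux ⇐ OrdinaryFactorisation ∧ OrdinaryPointsClassical` puts open content in BOTH factors unless the
weight character is moved into the interface (e.g. conclude in `OrdinaryFactorisation` that `x` is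
a point of `𝕋^{S,ord}(𝒰) ⊗_Λ,κ_k 𝒪`, or add the diamond character to `IsOrdAssociated`). Uniqueness
is not the issue: for `k, k' ≥ 2` a `ρ` ordinary of weights `k` and `k'` at `v` has `k = k'`
(`ε|_{I_v}` has infinite order) — the issue is producing the weight on the Hecke side at all.

**(S4) The `ζ_p ∈ F` corner.** The crux includes `F = ℚ(√-3)` with `p = 3` (and every `(F, p)` with
`p` ramified). Every printed automorphy lifting theorem a line might import in the residually
irreducible regime (ACC+ Thm 6.1.1/6.1.2, CN23, Thorne, Allen–Khare–Thorne) assumes `ζ_p ∉ F`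
(and usually `p > n² = 4` or `p ∤ 2n`): at `(ℚ(√-3), 3)` the image of `Γ_{F(ζ_p)} = Γ_F` cannot be
"enormous relative to `F(ζ_p)`" in the required sense and Taylor–Wiles primes `q ≡ 1 (p)` with the
needed Frobenius behaviour are constrained. A skeleton quoting such a theorem must carry `ζ_p ∉ F`
(or `p ≥ 5`) as an explicit case split, leaving this corner to a separate argument; the crux as typed
does not exclude it. (Not a refutation: FM predicts the corner too.)
-/

section PreAttack

variable {F : Type} [Field F] [NumberField F] {p : ℕ} [Fact p.Prime]

/-- **(S1) The slope dichotomy, proved**: for every continuous `ℚ̄_p`-point `x` of the Hida-tower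
Hecke algebra `𝕋^S(𝒰; p)` (any tame level `𝒰` of `GL₂/F`), every place `w` and index `j`, either
`‖x(T_{w,j})‖ = 1` or `‖x(T_{w,j})‖ < 1` and then `x(T_{w,j})^{m!} → 0`. For `w ∣ p`, `j = 1` this
is the card's `SlopeDichotomy` with the unit branch stated as a norm condition. [folklore] -/
theorem slopeDichotomy_norm (𝒰 : TameLevel 2 F p) (x : HidaHeckeAlgebraGLn 𝒰 →+* PadicAlgCl p)
    (hx : Continuous x) (w : HeightOneSpectrum (𝓞 F)) (j : ℕ) :
    ‖x (𝒰.hidaT w j)‖ = 1 ∨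
      (‖x (𝒰.hidaT w j)‖ < 1 ∧ Tendsto (fun m : ℕ => x (𝒰.hidaT w j) ^ m.factorial) atTop (𝓝 0)) :=
  norm_hidaT_eq_one_or_lt_one 𝒰 x hx w j

/-- **The unit branch** (p-adic analysis, NOT automorphic; true, not yet in the tree): a unit of
`𝒪_{ℚ̄_p}` has `u^{m!} → 1` (`u` lies in a finite `E/ℚ_p`; `u^{q_E - 1} ∈ 1 + 𝔪_E` and
`(1 + 𝔪_E)^{p^k} → 1`; `m!` is eventually divisible by `(q_E - 1)p^k`). Recorded as the exact residue
separating `slopeDichotomy_norm` from the card's `IsSlopeZeroAt` phrasing. [folklore] -/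
def UnitBranch : Prop :=
  ∀ (p : ℕ) [Fact p.Prime] (u : PadicAlgCl p), ‖u‖ = 1 →
    Tendsto (fun m : ℕ => u ^ m.factorial) atTop (𝓝 1)

/-- **The unit branch holds** (LANDED: `Negative.tendsto_pow_factorial_nhds_one`,
`Negative/SlopeDichotomy.lean`, p77203 — Teichmüller convergence on the unit sphere of `ℚ̄_p`). So the
card's `SlopeDichotomy` is the landed `Negative.slopeDichotomy`, verbatim, and
`IsSlopeZeroAt x v ↔ ‖x(U_{v,1})‖ = 1` is `Negative.isSlopeZeroAt_iff_norm_eq_one`. [folklore] -/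
theorem unitBranch_holds : UnitBranch := fun _ _ u hu => tendsto_pow_factorial_nhds_one u hu

/-- `IsSlopeZeroAt x v ↔ ‖x(U_{v,1})‖ = 1` for continuous points (landed, p77203). [folklore] -/
example (𝒰 : TameLevel 2 F p) (x : HidaHeckeAlgebraGLn 𝒰 →+* PadicAlgCl p) (hx : Continuous x)
    (v : HeightOneSpectrum (𝓞 F)) : 𝒰.IsSlopeZeroAt x v ↔ ‖x (𝒰.hidaT v 1)‖ = 1 :=
  isSlopeZeroAt_iff_norm_eq_one 𝒰 x hx v

/-- Given the unit branch, `‖x(U_{v,1})‖ = 1` IS `IsSlopeZeroAt x v` for `GL₂` (the only index is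
`j = 1`). [folklore] -/
theorem isSlopeZeroAt_of_norm_eq_one (hU : UnitBranch) (𝒰 : TameLevel 2 F p)
    (x : HidaHeckeAlgebraGLn 𝒰 →+* PadicAlgCl p) (v : HeightOneSpectrum (𝓞 F))
    (h : ‖x (𝒰.hidaT v 1)‖ = 1) : 𝒰.IsSlopeZeroAt x v := by
  intro j hj hj2
  obtain rfl : j = 1 := by omega
  exact hU p _ h

/-- Conversely the unit branch of `IsSlopeZeroAt` forces `‖x(U_{v,1})‖ = 1` for a continuous point
(a limit of powers of an element of norm `< 1` is `0 ≠ 1`; norm `> 1` is excluded by integrality).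
[folklore] -/
theorem norm_eq_one_of_isSlopeZeroAt (𝒰 : TameLevel 2 F p) (x : HidaHeckeAlgebraGLn 𝒰 →+* PadicAlgCl p)
    (hx : Continuous x) (v : HeightOneSpectrum (𝓞 F)) (h : 𝒰.IsSlopeZeroAt x v) :
    ‖x (𝒰.hidaT v 1)‖ = 1 := by
  rcases slopeDichotomy_norm 𝒰 x hx v 1 with h1 | ⟨-, h0⟩
  · exact h1
  · exact absurd (tendsto_nhds_unique (h 1 le_rfl one_lt_two) h0) one_ne_zero

variable (F p) in
/-- **(S2) "`p` splits in `F`" AS TYPED** in `OrdinaryFactorisationSplit` (card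
`paskunas-centre-split`): every place above `p` has norm `p`. Satisfied by split AND by ramified `p`.
[folklore] -/
def SplitHypothesisAsTyped : Prop :=
  ∀ v : HeightOneSpectrum (𝓞 F), (p : 𝓞 F) ∈ v.asIdeal → Ideal.absNorm v.asIdeal = p

variable (F p) in
/-- **(S2) corrected: `p` splits COMPLETELY in `F`** — residue degree one AND unramified (`v²` does
not divide `(p)`), which for `[F:ℚ] = 2` is "two distinct places above `p`", the hypothesis under
which `F_v = ℚ_p` and the `GL₂(ℚ_p)` lever applies. Suggested replacement for the first lemma's
split clause. [folklore] -/
def SplitsCompletelyAt : Prop :=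
  SplitHypothesisAsTyped F p ∧
    ∀ v : HeightOneSpectrum (𝓞 F), (p : 𝓞 F) ∈ v.asIdeal → ¬ v.asIdeal ^ 2 ∣ Ideal.span {(p : 𝓞 F)}

omit [Fact p.Prime] in
/-- The corrected clause implies the typed one (so a line proved under `SplitsCompletelyAt` proves
LESS than `OrdinaryFactorisationSplit` as typed: the ramified case is a genuine extra obligation of
the typed stub). [folklore] -/
theorem splitHypothesisAsTyped_of_splitsCompletelyAt (h : SplitsCompletelyAt F p) :
    SplitHypothesisAsTyped F p :=
  h.1

end PreAttack

/-! ## §8 Attack log (gen 2, cycle 2) and WHY IT STILL RESISTS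

Attacks run this cycle (2026-08-16T02:00Z–), cheapest first, all against the crux AS TYPED:
1. RE-ELABORATION / READ-BACK of every interface the crux quantifies over, one level deeper than
   cycle 1 (files `LocalGaloisGroup`, `AbsGaloisGroup`, `GaloisRep`, `OrdinaryGaloisRep`,
   `CompletedCohomologyHeckeAlgebraGLn`, `OrdinaryCompletedCohomologyGL`, summit `Statement`):
   no junk (§5). In particular the feared escapes — `absInertia = ⊥/⊤`, a placeholder cyclotomic
   character, a trivial `toLocal`, non-continuous `FramedGaloisRep`, `heckeT = 0` inside an
   association, the zero ring as a Hecke algebra — are all absent (`FramedRep = Γ →ₜ* GL`,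
   `H⁰ ∋` constants so `ℤ_p ⊆ 𝕋(𝒰)`, junk `0` only off Hida places).
2. NORMALISATION COHERENCE (re-done independently of the 2026-08-15 rattack note):
   `SatakeFrobCompatibleAt` matches the ARITHMETIC Frobenius of `ρ` with roots `ι⁻¹(α_j⁻¹)`; for an
   ordinary weight-`k` `ρ` (`det ρ = ψ ε^{k-1}`) the matching `π` is `π_u ⊗ |det|^{(k-1)/2}`, which IS
   L-algebraic (exponents `{k-1, 0}` at the complex place) — coherent; and existence of `π` is
   insensitive to the dual/arithmetic-vs-geometric dictionary (`π ↦ π^∨`). No half-integral twist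
   mismatch: the conclusion is satisfiable for classical `ρ`.
3. TYPE-LEVEL VACUITY of the remaining binders: `ι`, `hcpt` inhabited (§5) — no vacuous `Π`.
4. STRUCTURAL CONSTRAINTS on would-be witnesses: a counterexample needs a continuous point `x`; all
   such points are integral (landed, §6) — closes the "non-integral junk eigensystem" door on
   `𝕋(𝒰)` and, for the lines, on `𝕋^S(𝒰;p)` / `𝕋^{S,ord}(𝒰)`.
5. HYPOTHESIS MUTATION beyond cycle 1: orientation flip of `IsOrdinaryOfWeight` (would admit
   non-de-Rham `ρ`; the typed orientation is the right one, §5); `ζ_p ∈ F` corner (inside the crux,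
   outside printed ALTs, §7 S4); twist-stability (`ρ ↦ ρ ⊗ χ`, `χ` finite order: hypotheses and
   conclusion are stable, the existential `m` absorbing `χ|_{I_v}` — nothing to exploit).
6. PRE-ATTACK of the presumptive stubs (§7): one stub is a theorem (S1), one is mis-scoped (S2), one
   hides open content (S3).
7. LITERATURE (negatives): `lit search` (searchd) unavailable again this cycle at 02:07Z and 02:31Z
   (rc 75) — `search-degraded: searchd`; galaxy bm25 over web PDFs returned only noise for
   "Galois-ordinary ⇒ Hecke-ordinary, Bianchi, completed cohomology". Known to this seat and
   consistent with cycle 1: no counterexample to Fontaine–Mazur for `GL₂` over an imaginary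
   quadratic field is in print; the nearest negative phenomena (Calegari–Mazur 2009 non-classical
   nearly ordinary deformations; positive-slope / critical points) are excluded by `0 < m` + one
   parallel `k`; the nearest positive results (Hida control for `GL₂` over fields with complex
   places; Barrera Salazar–Williams small-slope classicality for Bianchi forms, arXiv:1404.2100;
   CN23 Thm 4.2.15 Hecke-ordinary ⇒ Galois-ordinary for non-Eisenstein `𝔪`) all point the same way.

WHY IT STILL RESISTS: unchanged from cycle 1 (`crux_of_ordinaryFontaineMazur`). Every attack that
does not produce an irreducible, pro-modular, Galois-ordinary, NON-classical `ρ` over an imaginary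
quadratic field is structurally incapable of refuting the crux, and producing one refutes
Fontaine–Mazur–Langlands (B) in a regular-weight sector over a CM field — against all evidence.
The crux's only non-FM lever, pro-modularity (`hpm`), is an `∃` over continuous points of a
constructed algebra none of whose non-Eisenstein points can presently be exhibited in Lean; the
formal doors (vacuous binders, junk interfaces, wrong orientation, non-integral points,
normalisation mismatch) are now all checked shut.

NEXT (re-arm on line pick / skeleton): attack the filed stubs — expected shapes
`OrdinaryFactorisation(Split)` (check the split clause, S2; attack at ramified `p` and at
`(ℚ(√-3), 3)`), `OrdinaryPointsClassical`/`ClassicalOfOrdinaryPoint` (S3: demand the weight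
character; a point of `𝕋^{S,ord}` of NON-arithmetic diamond weight associated with an
arithmetic-weight-ordinary `ρ` would falsify it — again FM-type, but the Eisenstein/`H⁰`-free
ORDINARY Eisenstein family `(χ, χ ε ⟨·⟩^{κ})` in `𝕋^{S,ord}` gives reducible test points where the
diamond weight and the Galois weight CAN be compared in the tree once `ordDiamondHom` is unfolded on
boundary classes), `SlopeDichotomy` (done, S1), `BianchiHeckeDeterminant` (a vendoring of Scholze
V.4 / Gee–Newton Rem. 3.3.3 for imaginary quadratic `F`): `I = ⊤` is excluded (`𝕋(𝒰)_𝔪 ≠ 0` for a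
maximal `𝔪`), but the typed `∀ 𝔪 maximal` ranges over ALL maximal ideals of the abstract ring `𝕋(𝒰)`,
including non-closed ones should they exist (compact rings can have dense maximal ideals, e.g.
`∏ 𝔽_p`); print covers them only through the semi-locality `𝕋 = ∏_𝔪 𝕋_𝔪` (Gee–Newton Lemma 2.1.8,
which uses finiteness of cohomology and of the set of mod-`p` eigensystems) — a vendored fact in
this shape silently includes that theorem; safer: quantify over `𝔪 = ker ψ` for a continuous
`ψ : 𝕋(𝒰) → k`, `k` finite (`IsResidualRepAt`-style), which is all any line uses.
-/

/-! ## §9 (gen 3, cycle 3) TARGETS — the six registered stubs of the PICKED line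
`top-degree-exact-control` (skeleton rev 2, `Lines/top-degree-exact-control.lean`, sha 540463fb…)

Composition (pure logic, checked in the skeleton): `stub1 → stub2a → stub2b → glue(2c) → stub3 → stub4 →
crux`. Status after this cycle (details below; the drefute seat's notes
`NegativeNotes-drefute-slotZeroDiamondWeight.md` / `SURVIVORS.md` were read and are CITED, not redone):

* **T1 `stub_ordinaryFactorisation`** (= (OF), Galois-ordinary ⇒ Hecke-ordinary; the transfer slot).
  OPEN, Fontaine–Mazur-type in the negative direction (a counterexample = an irreducible pro-modular
  Galois-ordinary `ρ` carried by NO point of Hida's ordinary part — nothing of the kind is known or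
  constructible); no cheap attack exists (§0, §8). FORMAL HAZARD (drefute R1, confirmed here): its OUTPUT
  `∃ 𝒰, IsMaximalAbove ∧ IsOrdinarilyPadicallyAutomorphic ρ` is too weak for the line — the ordering bit
  must travel inside this existential (see T2b), i.e. the honest transfer statement is
  "(OF) + the point has slot-`0` weight `0`" (`SlotZero.HasSlotZeroWeight 𝒰 x 0` below).
* **T2a `stub_centralDiamondWeight`** (centre of the diamond character has weight `2 - k`). SURVIVES;
  true on paper for EVERY associated point (drefute §5: `⟨û⟩_p = ∏_{w ∣ u} (T_{w,2}⁻¹)^{v_w(u)}` in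
  `𝕋^{S,ord}(𝒰)` for `u ≡ 1 mod 𝔫`, `x(T_{w,2}) = ψ(Frob_w) q_w^{k-2}` with `ψ = det ρ · ε^{1-k}` of finite
  order). Independent check of the one delicate step: the passage from `u ≡ 1 mod 𝔫` to ALL `u` prime to
  `p` is legitimate ONLY because the statement is "up to `N`-th powers" — `u ↦ x(⟨û⟩)·N(u)^{k-2}` is
  continuous on `∏_{v∣p} 𝒪_vˣ` (levelwise locally constant diamonds; `N(u) = ∏_{v∣p} Nm_{F_v/ℚ_p}(u)` is
  continuous), takes values in the finite set `μ_N` on the dense subset `{u ≡ 1 mod 𝔫}` (CRT, `𝔫` prime to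
  `p`), hence everywhere. An EXACT (power-free) version of 2a would be FALSE (nebentype at the tame level).
  Formal fact landed with T2b: the binder `û` is inhabited exactly for `u` prime to `p`
  (`SlotZero.exists_units_coe_eq_algebraMap`, `SlotZero.not_mem_asIdeal_of_units`), so `u = 0` and every
  `u` in some `v ∣ p` are vacuous instances — no junk there.
* **T2b `stub_slotZeroDiamondWeight`** (slot `0` torsion at EVERY associated point). **DEAD AS TYPED.**
  Paper witness (drefute): the companion (anti-dominant) ordinary refinement `x'` of a split-at-`p` CM point
  (`F = ℚ(√-11)`, `p = 5`, `ρ = V₅(32a2)|Γ_F`: irreducible, ordinary of weight `2`, `m = 1`, split at both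
  `v ∣ 5`) is a continuous point of `𝕋^{S,ord}(𝒰)` with the SAME `T_{w,1}, T_{w,2}` (`IsOrdAssociated` reads
  only `w ∉ S`) and slot-`0` character `Nm^{∓(k-1)}·`finite. CHECKED LEAN CORE (this file, `SlotZero.*`;
  proposal p82696 `Theorems/ProModularOrdinaryClassical/Negative/SlotZeroWeight.lean`): the slot-`0`
  weight of ANY map `x` on the algebra is a well-defined integer (`HasSlotZeroWeight.unique`: witness
  `u = p + 1`, norm `(p+1)^{[F:ℚ]} > 1`, a non-zero power of an integer `> 1` is never `1` in characteristic
  `0`) — so the stub (= "weight `0` at every associated point", `hasSlotZeroWeight_zero_of_stub`) is refuted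
  by ONE associated point of weight `j ≠ 0` (`stub_false_of_hasSlotZeroWeight`), whatever the sign
  conventions (`j = k - 1` or `1 - k` for the companion point; even if the tree's conventions swapped the two
  slots, classical points of weight `k ≥ 3` would themselves have `j = 2 - k ≠ 0`). Packaged hypothesis
  `NonzeroSlotZeroWeightPoint` (TRUE by Hida / Breuil–Emerton companion points; not constructible here) ⇒
  `¬ stub` (`stub_false_of_nonzeroSlotZeroWeightPoint`). [Landing note: the proposal file p82696 carries
  the predicates, the uniqueness theorems and `stub_false_of_hasSlotZeroWeight` with the registered signature
  INLINED; the closed `Prop`s `Stub` / `NonzeroSlotZeroWeightPoint` live only in this work file — the gate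
  relocates closed `def X : Prop` of a Summits file into `Literature/Uncategorized/`, where the stub cannot
  elaborate (p81618/p81637, p82264/p82268 bounced for that reason alone).] REPAIR = drefute R1 (delete 2b, put
  `HasSlotZeroWeight 𝒰 x 0` into the `∃ x` of T1) or R2 (add non-splitness of `ρ|Γ_{F_v}` at every `v ∣ p`,
  losing every CM point and the split members of the route's headline family).
* **T2c `stub_dominantOfCentralAndSlotZero`** (glue, pure algebra). SURVIVES (lead reports a proof:
  `diag(û,û) = diag(û,1)·diag(1,û)`, `ordDiamondHom` multiplicative under `IsMaximalAbove`, `x` of a unit is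
  a unit, `finprod_mul_distrib` over the finite type of places above `p`, `N = N₁N₂`). Nothing to attack.
* **T3 `stub_dominantPointsClassical`** (dominant ordinary `ℚ̄_p`-points associated with irreducible `ρ` are
  classical). SURVIVES every cheap attack; two checks recorded for the prover. (i) SUPPORT: `x` continuous,
  characteristic `0` (`p ∉ 𝔭_x`), `𝔭_x ∈ Supp_𝕋 H^b(F_∞)` for some `b ∈ {1, 2}` (`H^{≥3}` of non-neat levels
  is bounded torsion). If `b = 2`: top-degree exactness `H²(F_∞ ⊗_Λ Λ/P_k) = H²(F_∞)/P_k` and Nakayama at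
  `𝔭_x ⊇ P_k` (dominant weight!). If `𝔭_x ∉ Supp H²(F_∞)`: the only correction to the degree-`1` edge,
  `d₂ : Tor₂^Λ(H²(F_∞), Λ/P_k) → H¹(F_∞)/P_k`, has support inside `Supp H²(F_∞)`, so it vanishes after
  localising at `𝔭_x` and `(H¹(F_∞)/P_k)_{𝔭_x} ↪ H¹(F_∞ ⊗ Λ/P_k)_{𝔭_x}` is non-zero by Nakayama. Either way `x`
  occurs in `H^•_ord(U(c), V_k)[1/p]` (support commutes with inverting `p` for finitely generated modules),
  then Franke/Harder + irreducibility excludes the boundary. No gap found. (ii) NORMALISATION: the `π₀` to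
  take is the cohomological (`V_k`-coefficient) cuspidal representation ITSELF — its `T_{w,1}`-eigenvalue on
  spherical vectors IS the eigenvalue on `H^•(X_U, V_k)`, and for ANY unramified `π_w = Ind(χ₁, χ₂)` (unitary
  induction) `T_{w,1} ↦ q^{1/2}(χ₁(ϖ) + χ₂(ϖ)) = q^{1/2} e₁(α)`, `T_{w,2} ↦ e₂(α)`: exactly `HasSatakeParamAt`'s
  normalisation with `α` the Satake parameter of `π₀,w`; `IsRegularAlgebraic` = cohomological (Clozel). No
  half-integral mismatch for odd `k` (the central character at `∞` is `|·|_ℂ^{2-k}`, an integral power).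
  (iii) ι: the matching is stated for the crux's OWN `ι`, so the line never needs `Aut(ℂ)`-stability of
  cuspidal cohomological `π` (which holds anyway: rational structure on cuspidal cohomology, Harder/Clozel —
  this is also why the crux's `∀ ι` is not a loophole: a `ρ` classical for one `ι₀` is classical for all `ι`).
* **T4 `stub_satakeDictionary`**. SURVIVES; independent re-derivation agrees with the drefute: roots of
  `X² − x(T₁)X + q x(T₂)` are `ι⁻¹(q^{1/2}α_j)`, so `β_j = q^{-1/2}α_j⁻¹`, `π = π₀^∨ ⊗ |det|^{1/2}`, L-algebraic
  (C-algebraic `π₀`, `n = 2`). Provability hinges on the tree's `exists_contragredient_satake` being a proved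
  fact (it is a `def … : Prop`) and on the twist API; no falsity.
-/

namespace SlotZero

/-! ### §9b Lean core for T2b (mirrors the proposal `Negative/SlotZeroWeight.lean`, p82696, which carries the
predicates, the uniqueness theorems and the stub-false theorem with the registered signature INLINED; the closed
`Prop`s `Stub` and `NonzeroSlotZeroWeightPoint` exist only here; delete the local copies of the shared
declarations and import that module once it is in the tree) -/

/-- A non-zero integral power of an integer `c > 1` is never `1` in a field of characteristic `0`.
[folklore] -/
theorem int_cast_zpow_ne_one {K : Type*} [Field K] [CharZero K] {c : ℤ} (hc : 1 < c) {M : ℤ}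
    (hM : M ≠ 0) : (c : K) ^ M ≠ 1 := by
  intro h
  have h' : ((c : ℚ) : K) ^ M = ((1 : ℚ) : K) := by
    rw [Rat.cast_intCast, Rat.cast_one, h]
  rw [← Rat.cast_zpow, Rat.cast_inj] at h'
  have hinj := zpow_right_injective₀ (a := (c : ℚ)) (by exact_mod_cast (zero_lt_one.trans hc))
    (by exact_mod_cast hc.ne')
  exact hM (hinj (by simpa using h'))

section Units

variable {F : Type} [Field F] {p : ℕ}

/-- If `p ∈ v` then `p + 1 ∉ v` (else `1 ∈ v`). [folklore] -/
theorem natCast_succ_not_mem_asIdeal {v : HeightOneSpectrum (𝓞 F)} (hv : (p : 𝓞 F) ∈ v.asIdeal) :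
    ((p + 1 : ℕ) : 𝓞 F) ∉ v.asIdeal := by
  intro h
  apply v.isPrime.ne_top
  rw [Ideal.eq_top_iff_one]
  have e : ((p + 1 : ℕ) : 𝓞 F) - (p : 𝓞 F) = 1 := by push_cast; ring
  rw [← e]
  exact v.asIdeal.sub_mem h hv

variable [NumberField F]

/-- **Global elements prime to `p` give compatible local units**: the binder `û` of the diamond-weight
stubs is inhabited for every `u ∈ 𝓞 F` lying in no prime above `p`. [folklore] -/
theorem exists_units_coe_eq_algebraMap (u : 𝓞 F)
    (hu : ∀ v : HeightOneSpectrum (𝓞 F), (p : 𝓞 F) ∈ v.asIdeal → u ∉ v.asIdeal) :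
    ∃ û : ∀ v : HeightOneSpectrum (𝓞 F), (p : 𝓞 F) ∈ v.asIdeal → (v.adicCompletionIntegers F)ˣ,
      ∀ (v : HeightOneSpectrum (𝓞 F)) (hv : (p : 𝓞 F) ∈ v.asIdeal),
        ((û v hv : v.adicCompletionIntegers F) : v.adicCompletion F) =
          algebraMap F (v.adicCompletion F) (u : F) := by
  have key : ∀ v : HeightOneSpectrum (𝓞 F), (p : 𝓞 F) ∈ v.asIdeal →
      ∃ w : (v.adicCompletionIntegers F)ˣ,
        ((w : v.adicCompletionIntegers F) : v.adicCompletion F) =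
          algebraMap F (v.adicCompletion F) (u : F) := by
    intro v hv
    have hmem : algebraMap F (v.adicCompletion F) (u : F) ∈ v.adicCompletionIntegers F :=
      HeightOneSpectrum.coe_algebraMap_mem (𝓞 F) F v u
    have hval : Valued.v (algebraMap F (v.adicCompletion F) (u : F)) = 1 := by
      have e := HeightOneSpectrum.valuedAdicCompletion_eq_valuation' (v := v) (u : F)
      rw [show ((u : F) : v.adicCompletion F) = algebraMap F (v.adicCompletion F) (u : F) from rfl] at e
      rw [e, show (u : F) = algebraMap (𝓞 F) F u from rfl, HeightOneSpectrum.valuation_of_algebraMap,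
        HeightOneSpectrum.intValuation_eq_one_iff]
      exact hu v hv
    have hunit : IsUnit (⟨_, hmem⟩ : v.adicCompletionIntegers F) :=
      HeightOneSpectrum.adicCompletionIntegers.isUnit_iff_valued_eq_one.2 hval
    exact ⟨hunit.unit, by rw [IsUnit.unit_spec]⟩
  choose û hû using key
  exact ⟨û, hû⟩

/-- Conversely a compatible local unit at `v ∣ p` forces `u ∉ v`: the `û`-binder of the diamond-weight
stubs is EMPTY (the instance vacuous) for `u = 0` and for every `u` in some prime above `p`. [folklore] -/
theorem not_mem_asIdeal_of_units (u : 𝓞 F) (v : HeightOneSpectrum (𝓞 F))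
    (w : (v.adicCompletionIntegers F)ˣ)
    (hw : ((w : v.adicCompletionIntegers F) : v.adicCompletion F) =
      algebraMap F (v.adicCompletion F) (u : F)) :
    u ∉ v.asIdeal := by
  have h1 : Valued.v ((w : v.adicCompletionIntegers F) : v.adicCompletion F) = 1 :=
    HeightOneSpectrum.adicCompletionIntegers.isUnit_iff_valued_eq_one.1 (Units.isUnit w)
  rw [hw] at h1
  have e := HeightOneSpectrum.valuedAdicCompletion_eq_valuation' (v := v) (u : F)
  rw [show ((u : F) : v.adicCompletion F) = algebraMap F (v.adicCompletion F) (u : F) from rfl] at e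
  rw [e, show (u : F) = algebraMap (𝓞 F) F u from rfl, HeightOneSpectrum.valuation_of_algebraMap,
    HeightOneSpectrum.intValuation_eq_one_iff] at h1
  exact h1

/-- `N_{F/ℚ}(p + 1) = (p+1)^{[F:ℚ]} > 1`. [folklore] -/
theorem one_lt_norm_natCast_succ [Fact p.Prime] :
    1 < Algebra.norm ℤ (((p + 1 : ℕ) : 𝓞 F)) := by
  rw [Algebra.norm_natCast, RingOfIntegers.rank]
  have hd : Module.finrank ℚ F ≠ 0 := Module.finrank_pos.ne'
  have hp : (1 : ℤ) < ((p + 1 : ℕ) : ℤ) := by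
    have := (Fact.out : p.Prime).one_lt
    omega
  exact one_lt_pow₀ hp hd

end Units

section Weight

variable {F : Type} [Field F] [NumberField F] {p : ℕ} [Fact p.Prime]

/-- **`P` has algebraic weight `j`** (up to `N₀`-th powers), for an arbitrary `ℚ̄_p`-valued quantity
`P(u, û)` on global `u` prime to `p` and compatible local units `û` — centre product (T2a: weight `2 - k`),
slot-`0` product (T2b: weight `0`), slot-`1` product (`HasDominantDiamondWeight`: weight `2 - k`). [folklore] -/
def HasDiamondWeight
    (P : ∀ (u : NumberField.RingOfIntegers F),
      (∀ v : IsDedekindDomain.HeightOneSpectrum (NumberField.RingOfIntegers F),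
        (p : NumberField.RingOfIntegers F) ∈ v.asIdeal → (v.adicCompletionIntegers F)ˣ) → PadicAlgCl p)
    (j : ℤ) : Prop :=
  ∃ N₀ : ℕ, 0 < N₀ ∧ ∀ (u : NumberField.RingOfIntegers F)
    (û : ∀ v : IsDedekindDomain.HeightOneSpectrum (NumberField.RingOfIntegers F),
      (p : NumberField.RingOfIntegers F) ∈ v.asIdeal → (v.adicCompletionIntegers F)ˣ),
    (∀ (v : IsDedekindDomain.HeightOneSpectrum (NumberField.RingOfIntegers F))
        (hv : (p : NumberField.RingOfIntegers F) ∈ v.asIdeal),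
        ((û v hv : v.adicCompletionIntegers F) : v.adicCompletion F) =
          algebraMap F (v.adicCompletion F) (u : F)) →
    P u û ^ N₀ = (((Algebra.norm ℤ u : ℤ) : PadicAlgCl p) ^ j) ^ N₀

/-- **Algebraic weights are unique** (`P` any function; witness `u = p + 1`): the centre weight of T2a and
the slot weights of `HasDominantDiamondWeight` are invariants of the point. [folklore] -/
theorem HasDiamondWeight.unique
    {P : ∀ (u : NumberField.RingOfIntegers F),
      (∀ v : IsDedekindDomain.HeightOneSpectrum (NumberField.RingOfIntegers F),
        (p : NumberField.RingOfIntegers F) ∈ v.asIdeal → (v.adicCompletionIntegers F)ˣ) → PadicAlgCl p}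
    {j j' : ℤ} (h : HasDiamondWeight P j) (h' : HasDiamondWeight P j') : j = j' := by
  obtain ⟨N, hN, hS⟩ := h
  obtain ⟨N', hN', hS'⟩ := h'
  set u : 𝓞 F := ((p + 1 : ℕ) : 𝓞 F) with hu
  obtain ⟨û, hû⟩ := exists_units_coe_eq_algebraMap (p := p) u
    (fun v hv => natCast_succ_not_mem_asIdeal hv)
  have e1 := hS u û hû
  have e2 := hS' u û hû
  set c : ℤ := Algebra.norm ℤ u with hc
  have hc1 : 1 < c := one_lt_norm_natCast_succ
  have key : ((c : PadicAlgCl p) ^ j) ^ (N * N') = ((c : PadicAlgCl p) ^ j') ^ (N * N') := by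
    rw [pow_mul, ← e1, ← pow_mul, mul_comm N N', pow_mul, e2, ← pow_mul]
  have hc0 : (c : PadicAlgCl p) ≠ 0 := by exact_mod_cast (zero_lt_one.trans hc1).ne'
  have key' : (c : PadicAlgCl p) ^ ((j - j') * ((N * N' : ℕ) : ℤ)) = 1 := by
    rw [sub_mul, zpow_sub₀ hc0, div_eq_one_iff_eq (zpow_ne_zero _ hc0), zpow_mul, zpow_mul,
      zpow_natCast, zpow_natCast, key]
  by_contra hne
  refine int_cast_zpow_ne_one (K := PadicAlgCl p) hc1 ?_ key'
  refine mul_ne_zero (sub_ne_zero.2 hne) ?_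
  exact_mod_cast (Nat.mul_pos hN hN').ne'

/-- **Slot `0` of the diamond character of `x` has weight `j`** (up to `N₀`-th powers), binders verbatim
those of `stub_slotZeroDiamondWeight` (whose conclusion is weight `0`). [folklore] -/
def HasSlotZeroWeight (𝒰 : TameLevel 2 F p) (x : OrdinaryHeckeAlgebraGLn 𝒰 →+* PadicAlgCl p)
    (j : ℤ) : Prop :=
  ∃ N₀ : ℕ, 0 < N₀ ∧ ∀ (u : NumberField.RingOfIntegers F)
    (û : ∀ v : IsDedekindDomain.HeightOneSpectrum (NumberField.RingOfIntegers F),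
      (p : NumberField.RingOfIntegers F) ∈ v.asIdeal → (v.adicCompletionIntegers F)ˣ),
    (∀ (v : IsDedekindDomain.HeightOneSpectrum (NumberField.RingOfIntegers F))
        (hv : (p : NumberField.RingOfIntegers F) ∈ v.asIdeal),
        ((û v hv : v.adicCompletionIntegers F) : v.adicCompletion F) =
          algebraMap F (v.adicCompletion F) (u : F)) →
    (∏ᶠ v : {v : IsDedekindDomain.HeightOneSpectrum (NumberField.RingOfIntegers F) //
        (p : NumberField.RingOfIntegers F) ∈ v.asIdeal},
      x (𝒰.ordDiamond v.2 (Pi.mulSingle (0 : Fin 2) (û v.1 v.2)))) ^ N₀ =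
      (((Algebra.norm ℤ u : ℤ) : PadicAlgCl p) ^ j) ^ N₀

/-- **The slot-`0` weight is an invariant of the point** (any map `x`; no continuity, no association):
`HasDiamondWeight.unique` for the slot-`0` product. [folklore] -/
theorem HasSlotZeroWeight.unique {𝒰 : TameLevel 2 F p}
    {x : OrdinaryHeckeAlgebraGLn 𝒰 →+* PadicAlgCl p} {j j' : ℤ}
    (h : HasSlotZeroWeight 𝒰 x j) (h' : HasSlotZeroWeight 𝒰 x j') : j = j' :=
  HasDiamondWeight.unique
    (P := fun _ û => ∏ᶠ v : {v : IsDedekindDomain.HeightOneSpectrum (NumberField.RingOfIntegers F) //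
        (p : NumberField.RingOfIntegers F) ∈ v.asIdeal},
      x (𝒰.ordDiamond v.2 (Pi.mulSingle (0 : Fin 2) (û v.1 v.2))))
    h h'

/-- `stub_slotZeroDiamondWeight` (registered, rev 2) restated byte-for-byte. [folklore] -/
def Stub : Prop :=
  ∀ (F : Type) [Field F] [NumberField F], NumberField.IsTotallyComplex F → Module.finrank ℚ F = 2 → ∀ (p : ℕ) [Fact p.Prime], p ≠ 2 → ∀ (ρ : Literature.NumberTheory.GaloisRepresentations.FramedGaloisRep F (PadicAlgCl p) 2) (𝒰 : Literature.NumberTheory.Automorphic.BigHeckeGLn.TameLevel 2 F p) (x : Literature.NumberTheory.Automorphic.OrdinaryHeckeAlgebraGLn 𝒰 →+* PadicAlgCl p) (k m : ℕ), ρ.toGaloisRep.IsIrreducible → 𝒰.IsMaximalAbove → Continuous x → 𝒰.IsOrdAssociated x ρ → 2 ≤ k → 0 < m → (∀ v : IsDedekindDomain.HeightOneSpectrum (NumberField.RingOfIntegers F), (p : NumberField.RingOfIntegers F) ∈ v.asIdeal → ρ.IsOrdinaryOfWeightAt p v k m) → ∃ N : ℕ, 0 < N ∧ ∀ (u : NumberField.RingOfIntegers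 F) (û : ∀ v : IsDedekindDomain.HeightOneSpectrum (NumberField.RingOfIntegers F), (p : NumberField.RingOfIntegers F) ∈ v.asIdeal → (v.adicCompletionIntegers F)ˣ), (∀ (v : IsDedekindDomain.HeightOneSpectrum (NumberField.RingOfIntegers F)) (hv : (p : NumberField.RingOfIntegers F) ∈ v.asIdeal), ((û v hv : v.adicCompletionIntegers F) : v.adicCompletion F) = algebraMap F (v.adicCompletion F) (u : F)) → (∏ᶠ v : {v : IsDedekindDomain.HeightOneSpectrum (NumberField.RingOfIntegers F) // (p : NumberField.RingOfIntegers F) ∈ v.asIdeal}, x (𝒰.ordDiamond v.2 (Pi.mulSingle (0 : Fin 2) (û v.1 v.2)))) ^ N = 1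

/-- The stub says: slot `0` has weight `0` at every associated point. [folklore] -/
theorem hasSlotZeroWeight_zero_of_stub (hstub : Stub)
    (hF : IsTotallyComplex F) (hdeg : Module.finrank ℚ F = 2) (hp : p ≠ 2)
    (ρ : FramedGaloisRep F (PadicAlgCl p) 2) (𝒰 : TameLevel 2 F p)
    (x : OrdinaryHeckeAlgebraGLn 𝒰 →+* PadicAlgCl p) (k m : ℕ)
    (hirr : ρ.toGaloisRep.IsIrreducible) (hmax : 𝒰.IsMaximalAbove) (hx : Continuous x)
    (hass : 𝒰.IsOrdAssociated x ρ) (hk : 2 ≤ k) (hm : 0 < m)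
    (hord : ∀ v : HeightOneSpectrum (𝓞 F), (p : 𝓞 F) ∈ v.asIdeal → ρ.IsOrdinaryOfWeightAt p v k m) :
    HasSlotZeroWeight 𝒰 x 0 := by
  obtain ⟨N, hN, h⟩ := hstub F hF hdeg p hp ρ 𝒰 x k m hirr hmax hx hass hk hm hord
  exact ⟨N, hN, fun u û hû => by rw [h u û hû, zpow_zero, one_pow]⟩

/-- **T2b is dead modulo one point**: an associated point of slot-`0` weight `j ≠ 0` meeting the stub's
hypotheses refutes `stub_slotZeroDiamondWeight`. [folklore] -/
theorem stub_false_of_hasSlotZeroWeight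
    (hF : IsTotallyComplex F) (hdeg : Module.finrank ℚ F = 2) (hp : p ≠ 2)
    (ρ : FramedGaloisRep F (PadicAlgCl p) 2) (𝒰 : TameLevel 2 F p)
    (x : OrdinaryHeckeAlgebraGLn 𝒰 →+* PadicAlgCl p) (k m : ℕ)
    (hirr : ρ.toGaloisRep.IsIrreducible) (hmax : 𝒰.IsMaximalAbove) (hx : Continuous x)
    (hass : 𝒰.IsOrdAssociated x ρ) (hk : 2 ≤ k) (hm : 0 < m)
    (hord : ∀ v : HeightOneSpectrum (𝓞 F), (p : 𝓞 F) ∈ v.asIdeal → ρ.IsOrdinaryOfWeightAt p v k m)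
    {j : ℤ} (hj : j ≠ 0) (hH : HasSlotZeroWeight 𝒰 x j) : ¬ Stub := fun hstub =>
  hj (hH.unique (hasSlotZeroWeight_zero_of_stub hstub hF hdeg hp ρ 𝒰 x k m hirr hmax hx hass hk hm hord))

end Weight

/-- **H**: an associated point of non-zero slot-`0` weight meeting the stub's hypotheses exists (TRUE:
companion refinements of split-at-`p` CM points; not constructible in the tree). [folklore] -/
def NonzeroSlotZeroWeightPoint : Prop :=
  ∃ (F : Type) (_ : Field F) (_ : NumberField F) (p : ℕ) (_ : Fact p.Prime)
    (ρ : FramedGaloisRep F (PadicAlgCl p) 2) (𝒰 : TameLevel 2 F p)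
    (x : OrdinaryHeckeAlgebraGLn 𝒰 →+* PadicAlgCl p) (k m : ℕ) (j : ℤ),
    IsTotallyComplex F ∧ Module.finrank ℚ F = 2 ∧ p ≠ 2 ∧
    ρ.toGaloisRep.IsIrreducible ∧ 𝒰.IsMaximalAbove ∧ Continuous x ∧ 𝒰.IsOrdAssociated x ρ ∧
    2 ≤ k ∧ 0 < m ∧
    (∀ v : HeightOneSpectrum (𝓞 F), (p : 𝓞 F) ∈ v.asIdeal → ρ.IsOrdinaryOfWeightAt p v k m) ∧
    j ≠ 0 ∧ HasSlotZeroWeight 𝒰 x j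

/-- `stub_slotZeroDiamondWeight` is false modulo `NonzeroSlotZeroWeightPoint`. [folklore] -/
theorem stub_false_of_nonzeroSlotZeroWeightPoint (h : NonzeroSlotZeroWeightPoint) : ¬ Stub := by
  obtain ⟨F, _, _, p, _, ρ, 𝒰, x, k, m, j, hF, hdeg, hp, hirr, hmax, hx, hass, hk, hm, hord, hj, hH⟩ := h
  exact stub_false_of_hasSlotZeroWeight hF hdeg hp ρ 𝒰 x k m hirr hmax hx hass hk hm hord hj hH

end SlotZero

/-! ## §10 Attack log (gen 3, cycle 3) and WHY IT STILL RESISTS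

Attacks run this cycle (2026-08-16T03:54Z–), all against the crux AS TYPED and the registered stubs:
1. RE-READ of the tree state: Disproof v4, PICKED.md, skeleton rev 2, the six registered stub signatures
   (from the item's registry, not from the file), drefute notes, crux NOTES, OF-dossier. No skeleton edit by
   the lead since rev 2 (lead cycles: 0) — the targets are rev 2's stubs.
2. TARGETS (§9): one stub dead as typed (T2b, conditional Lean kill mirrored in §9b and proposed under
   `Negative/`), one formal hazard (T1's output too weak for the line), four survive with prover briefings
   (T2a density step, T3 support/Tor₂ localisation and normalisation, T4 `β = q^{-1/2}α⁻¹`, T2c algebra).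
3. CRUX-LEVEL, new this cycle: (a) the `∀ ι` binder is not a loophole (T3 (iii): matching is produced for the
   given `ι`; classicality is `Aut(ℂ)`-stable for cohomological cuspidal `π` on `GL₂/F`); (b) finite-image
   (Artin) `ρ` cannot satisfy H4 (`θ₁^m = ε^{(k-1)m}` has infinite order on `I_v` for `k ≥ 2`, `m ≥ 1`), so the
   crux does not secretly assert "icosahedral ⇒ weight ≥ 2 classical" — consistent with §1d; (c) `ψ = det ρ ·
   ε^{1-k}` IS of finite order under H4 at every `v ∣ p` (finite on all inertia groups + a.e. unramified ⇒ the
   abelian extension cut out has finite ramification at `p`, hence contains no `ℤ_p`-extension), which is the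
   Galois input of T2a — no hidden Leopoldt-type gap; (d) continuity of the point inside `IsPadicallyAutomorphic`
   cannot be dropped for free (it is what makes points integral, §6), but a discontinuous associated point is
   not constructible either — no lever.
4. CONSOLIDATION: v5 imports all five landed `Negative/` modules; the v4 local copies of
   `heckeFrobPoly_two_eisenstein`, `hpm_point_integral`, `norm_trace_det_frob_le_one` are now `example`s of the
   imports, and `unitBranch_holds : UnitBranch` is a theorem (from `Negative.tendsto_pow_factorial_nhds_one`).
5. LITERATURE (negatives): `search-degraded` again — local FTS index unreadable ("unable to open database
   file"), OpenAlex daily budget exhausted (429), S2 429 at 04:40Z; the gate socket was also down 04:35Z– (the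
   `Negative/SlotZeroWeight.lean` proposal went in as p82696 once it returned, 05:27Z). Nothing new
   in print is known to this seat beyond the lead's OF-dossier (AHTW 2026 = arXiv:2607.11763 and
   Ivančić–McDonald arXiv:2605.03519 are positive/partial LGC results, none a counterexample; CN23 4.2.15 and
   Hevesi exclude imaginary quadratic `F`).

WHY IT STILL RESISTS: unchanged (§0 `crux_of_ordinaryFontaineMazur`): a kill of the crux is a counterexample
to Fontaine–Mazur–Langlands (B) for `GL₂` over an imaginary quadratic field in a regular ordinary sector. The
line's weak joint is not the crux but its OWN cut: T1 must output the ordering (T2b dead), and T1 itself is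
(OF), open in every residual regime for `p`-adic points over `F`.

CONVENTION CHECK FOR R1 (done this cycle, third independent derivation after the card's and the drefute's):
R1 asks the transfer stub to output a point of slot-`0` weight `0`; this is NOT vacuous-by-sign. From the tree's
definitions: `hidaLevel r` is UPPER triangular at `v ∣ p` (`IwahoriCond.lower`: entries strictly below the
diagonal small; diagonal `≡ 1 mod ϖ^r`), so `U(r) ⊇ N(𝒪_v)` (upper unipotents) and `U_{v,1} = [U(r) diag(ϖ_v,1) U(r)]`
with representatives `(ϖ t; 0 1)` acting by right translation — the genuine `U_p`, whose unit eigenvalue at a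
classical ordinary point is the Frobenius eigenvalue on the unramified QUOTIENT. The centre weight `2 - k`
(T2a, Hecke-side: `⟨u⟩_p = ∏ T_{w,2}^{-v_w(u)}`, `x(T_{w,2}) = ψ(Frob_w) q_w^{k-2}`) forces the finite-level
coefficient module at `v` to be `W_v = Sym^{k-2}(std_v)` with NO determinant twist in the (only consistent)
right-action model `f(xu) = u_p⁻¹ f(x)` (a `det^j` twist shifts the centre weight by `-2j`; `Sym^{k-2}(std^∨)`
would give `k - 2`). The comparison with trivial coefficients up the tower goes through the `N(𝒪_v)`-invariant
FUNCTIONAL `λ` = coefficient of `e₂^{k-2}` (upper unipotents fix `e₁`; `λ(u⁻¹w) ≡ λ(w)` mod `p^s` for `u ∈ U(r)_v`,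
`r ≥ s`; it is also the component on which the integrally renormalised `diag(ϖ,1)` acts by a unit, i.e. the
ordinary one), and `F = λ ∘ f` satisfies `F(x·diag(a,δ)_v) = λ(diag(a,δ)⁻¹ f(x)) = δ^{2-k} F(x)` up to the finite
nebentype: slot `1` has weight `2 - k`, slot `0` has weight `0` at every classical parallel-weight-`k` point —
the card's type `(0, 2-k)`. So `HasDominantDiamondWeight` is satisfiable by classical points and R1's
`HasSlotZeroWeight 𝒰 x 0` holds at the dominant refinement; the companion refinement has slot-`0` weight
`∓(k-1) ≠ 0` either way.

NEXT (re-arm on the lead's reshape): if R1 is adopted, the new transfer stub `stub_ordinaryFactorisationSlotZero`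
(= (OF) + ordering) is FM-type like T1 and correctly excludes the companion point by fiat — attack only its
typing (the `HasSlotZeroWeight 𝒰 x 0` clause should be imported from `Negative/SlotZeroWeight.lean`, not
restated); if R2 (non-split at every `v ∣ p`), record the CM/split exclusion as a scope loss of the line against
the route's headline family `FiveIsogenyEllipticCurves` (split members) and every CM point.
-/

end Summit.Langlands.Langlands.Cruxes.ProModularOrdinaryClassical.Disproof
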